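import Mathlib.Data.Nat.Log
import Mathlib.Data.Fintype.BigOperators
import Mathlib.Algebra.BigOperators.Fin
import Mathlib.Analysis.SpecificLimits.Basic
import Mathlib.Analysis.Asymptotics.SpecificAsymptotics
import Literature.Computability.Cryptography.SISFunction
import Literature.Computability.Cryptography.OneWayFunctions
import Literature.Computability.Cryptography.LiuPassPadding
import Literature.Computability.MetaComplexity.FregeProofs
import HarnessLib

/-!
# The SIS′ solver built from an inverter of Ajtai's function: the reduction and its analysis

Topic `Computability/Cryptography` (family `pqc`), namespaces `Literature.SIS` (the reduction and its
analysis) and `Literature.PQC` (one named fact, one assembly theorem). Third brick of the decomposition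
of the named fact `Literature.Computability.Cryptography.owfExist_of_gapSVP_worstCaseHard` (`LatticeOWF.lean`): the
probabilistic core `Literature.Computability.Cryptography.Ajtai1996_sisFunction_core` of the SIS-function step
(`SISFunction.lean`: "a PPT inverter of Ajtai's packaged function `SIS.sisFunction` succeeding
with probability `≥ 1/kᶜ` yields a PPT algorithm solving SIS′ on the average in dimension
`dimOf k` with probability `≥ 1/n^{c'}`") is PROVED here up to running time. We write down the
reduction explicitly as a randomized algorithm `SIS.sisSolver A cb` (Def. `RandAlg`: a function
of input and coins plus a coin budget; `cb` is a bound for the inverter's coin budget, of which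
only a polynomial BOUND is part of "PPT", so the solver guesses the inverter's exact coin count
below `cb` at a polynomial loss) and prove its success guarantee; what remains a named fact is
only that this explicit algorithm runs in polynomial time given that Ajtai's function does
(`Literature.Computability.Cryptography.sisSolver_polyTime`, TM2 level, conditional on `sisFunction_polyTimeComputable` so as
not to re-absorb that separately named debt), its polynomial coin budget being proved.

* The reduction (Micciancio–Regev 2007, §5.1, p. 18, with Ajtai 1996, Thm. 1, in Goldreich's
  single-function packaging, 2001, §2.4.2). On an instance `encodeMatrix M`, `M ∈ ℤ_q^{n×m}`
  (`q = SIS.modulus n = 2^t`, `m = SIS.width n`): read `n` and the key bits off the input syntactically (`SIS.nOf`, `SIS.keyOf`); with the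
  first `guessBits n = ⌊log₂ blockLen n⌋ + 1` coins guess a padding length `u < blockLen n`, i.e. a
  security parameter `k = keyLen n + u` in the block `dimOf⁻¹(n)`; take `x ∈ {0,1}^m` and `u`
  padding bits from the next coins; form the query `w = (M, x, pad)` (`SIS.query`, key written
  with `SIS.matrixToBits`, the inverse of `SIS.parseMatrix`) and the inverter's input
  `y = (1^k, sisFunction w)`; guess the inverter's coin count `L ≤ cb |y|` from the next
  `lenBits cb n` coins and run `A` on `y` with the next `L` coins; parse `x'` from the answer and
  output the code of `x - x'` (`SIS.solverCore`, `SIS.sisSolver`).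
* Correctness of one run (`SIS.sisSolver_success`): if the answer is a preimage whose parsed
  vector differs from `x`, the output is an SIS′_{q,m,β} solution (`SIS.isSolution'_of_answer`,
  from `SIS.isSolution'_sub_of_collision` and `√m ≤ β`).
* Analysis, all PROVED, with probabilities unfolded to normalised sums over coin strings
  (`SIS.pr_eq_sum_div`, `SIS.sum_vector_append`, `SIS.sum_vector_take`):
  `SIS.sum_pr_goodSet_le` (for a fixed key, `2^g 2^m 2^p · Pr[solver succeeds] ≥ ∑_{x,pad}
  Pr[A returns a preimage with x' ≠ x]`), `SIS.sum_pr_selfSet_le` (self-returns: for fixed key,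
  padding and coins the inverter is a function of the image `f_M(x)` (`SIS.inpOf_query`), so it
  returns `x` itself for at most `qⁿ` of the `2^m` values of `x`, `SIS.sum_ite_inv_eq_le`),
  `SIS.sum_pr_succ_eq` (uniform key, `x` and padding form exactly the uniform challenge of
  `invertProb`: `ℤ_q^{n×m} ≃ {0,1}^{n m t}`, `SIS.matrixToVec_bijective`), giving
  `SIS.successProb'_sisSolver_ge`:
  `Pr[sisSolver A cb solves SIS′ in dim n] ≥ (invertProb A k - qⁿ/2^m) / (2^{guessBits n} 2^{lenBits cb n})`
  for every `k` in the block of `n`; and the asymptotic packaging `SIS.sisSolver_reduction` (`k`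
  and the guess factors polynomial in `n`, `qⁿ/2^m ≤ 2^{-n}`), in the exact format of
  `Ajtai1996_sisFunction_core`.
* `Literature.PQC.Ajtai1996_sisFunction_core_of_solver :
    sisFunction_polyTimeComputable → sisSolver_polyTime → Ajtai1996_sisFunction_core`.

Relocations owed (generic material housed here for now): `SIS.sum_vector_append` and
`SIS.sum_vector_take` are the `++`/sum-form siblings of `Literature.Computability.Cryptography.sum_vector_add` and
`Literature.Computability.Cryptography.uniformAvg_take` (`LiuPassPadding.lean`, the survivors; the coin-splitting
equivalence is `Literature.Computability.Cryptography.vecSplitEquiv`) and belong next to them; the seven closure lemmas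
`Literature.LWE.IsPolyBounded.add/mul/const/id/comp_succ/of_le/exists_monotone_bound` belong next to the
definition of `IsPolyBounded` (`LWENoise.lean`); the encoding-length lemmas used here are those of
`Literature.CplxCore` (`length_encode_listBool`, `length_encodeNat_le`, `length_unaryEncodeNat`,
currently in `MetaComplexity/FregeProofs.lean`), and the fixed-width binary code is
`Literature.Computability.Cryptography.natBits` (`LiuPassWeakOWF.lean`), `SIS.bitsToNat` being bridged to the
canonical `Literature.Computability.Complexity.bitsToNat` (`SIS.bitsToNat_eq`).

Documented conventions: `blockLen n = keyLen (n+1) - keyLen n` is a genuine difference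
(`keyLen` is strictly increasing, `SIS.one_le_blockLen`); `Finset.sup` is taken over the nonempty
ranges `[0, N]`; decoders return the junk value `0` off the image of the encoders (only the
`decode ∘ encode` lemmas are used).

## References

* M. Ajtai, *Generating hard instances of lattice problems*, STOC 1996, Thm. 1.
* D. Micciancio, O. Regev, *Worst-case to average-case reductions based on Gaussian measures*,
  SIAM J. Comput. 37 (2007); full version §5.1 (p. 18: the family `f_A`, collisions and SIS).
* O. Goldreich, *Foundations of Cryptography I*, CUP 2001, Def. 2.2.1 (inversion probability),
  §2.4.1–2.4.2 (length conventions; a collection as one function), §1.3.2 (PPT).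
* C. Peikert, *A decade of lattice cryptography*, 2016, §4.1.1 (inverting a compressing `f_A`
  yields collisions).
* S. Arora, B. Barak, *Computational Complexity*, CUP 2009, §0.1, §7.1, Def. 7.1.
-/

noncomputable section

open Filter Computability Literature.Computability.Complexity Literature.Computability.MetaComplexity Literature.Algebra.EuclideanLattices Literature.Computability.Cryptography Literature.Computability.Cryptography.LWE

namespace Literature.Computability.Cryptography

namespace SIS

/-! ### Sums over bit strings of a fixed length -/

/-- Fubini for uniform bit strings: a sum over `{0,1}^{a+b}` is an iterated sum over prefixes
and suffixes — the `f (s ++ u)` form of `Literature.Computability.Cryptography.sum_vector_add`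
(`LiuPassPadding.lean`, stated for `φ (v.take a) (v.drop a)`), of which it is a two-line
corollary. [folklore] -/
theorem sum_vector_append {M : Type*} [AddCommMonoid M] (a b : ℕ) (f : List Bool → M) :
    ∑ r : List.Vector Bool (a + b), f r.toList =
      ∑ s : List.Vector Bool a, ∑ u : List.Vector Bool b, f (s.toList ++ u.toList) := by
  rw [← Cryptography.sum_vector_add a b (fun x y => f (x ++ y))]
  simp only [List.take_append_drop]

/-- Transport of a sum over `{0,1}^c` along `c = d`. [folklore] -/
theorem sum_vector_cast {M : Type*} [AddCommMonoid M] {c d : ℕ} (h : c = d) (f : List Bool → M) :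
    ∑ r : List.Vector Bool c, f r.toList = ∑ r : List.Vector Bool d, f r.toList := by
  subst h; rfl

/-- A sum over `{0,1}^K` of a function of the first `k ≤ K` bits: each prefix has `2^{K-k}`
extensions. [folklore] -/
theorem sum_vector_take {k K : ℕ} (hk : k ≤ K) (f : List Bool → ℝ) :
    ∑ r : List.Vector Bool K, f (r.toList.take k) =
      2 ^ (K - k) * ∑ s : List.Vector Bool k, f s.toList := by
  have h1 : ∑ r : List.Vector Bool K, f (r.toList.take k) =
      ∑ r : List.Vector Bool (k + (K - k)), f (r.toList.take k) :=
    sum_vector_cast (Nat.add_sub_cancel' hk).symm (fun l => f (l.take k))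
  have h2 : ∑ r : List.Vector Bool (k + (K - k)), f (r.toList.take k) =
      ∑ s : List.Vector Bool k, ∑ u : List.Vector Bool (K - k), f ((s.toList ++ u.toList).take k) :=
    sum_vector_append k (K - k) (fun l => f (l.take k))
  rw [h1, h2, Finset.mul_sum]
  refine Finset.sum_congr rfl fun s _ => ?_
  rw [Finset.sum_congr rfl fun (u : List.Vector Bool (K - k)) _ =>
    show f ((s.toList ++ u.toList).take k) = f s.toList by
      rw [List.take_left' s.toList_length]]
  simp [card_vector]

/-- The number of coin strings in an event, as a sum of indicators (real-valued). [folklore] -/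
theorem natCard_setOf_eq_sum {ι : Type*} [Fintype ι] (P : ι → Prop) [DecidablePred P] :
    (Nat.card {i : ι | P i} : ℝ) = ∑ i, if P i then (1 : ℝ) else 0 := by
  rw [Nat.card_eq_fintype_card, Fintype.card_subtype]
  simp

/-- A `RandAlg` probability as a normalised sum of indicators over the coin strings.
[Arora–Barak 2009, §7.1] [folklore] -/
theorem pr_eq_sum_div {α β : Type} (A : RandAlg α β) (ea : α → List Bool) (x : α) (E : Set β)
    [DecidablePred (· ∈ E)] {L : ℕ} (hL : A.coinLen (ea x).length = L) :
    A.pr ea x E = (∑ r : List.Vector Bool L, if A.run x r.toList ∈ E then (1 : ℝ) else 0) / 2 ^ L := by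
  rw [A.pr_eq_card_div ea x E hL]
  congr 1
  exact natCard_setOf_eq_sum (fun r : List.Vector Bool L => A.run x r.toList ∈ E)

/-! ### Fixed-width binary representation -/

-- The fixed-width little-endian code `natBits t v` of `v` and its lemmas `length_natBits`,
-- `bitsVal_natBits` are the generic ones of `Literature.CryptoFoundations` (`LiuPassWeakOWF.lean`); the
-- value function read by `parseMatrix` is `SIS.bitsToNat` (`SISFunction.lean`, `Nat.ofDigits`
-- form), which the two bridges below identify with the canonical recursive copies
-- `Literature.Computability.Complexity.bitsToNat` (`BoolEncodings.lean`) and `Literature.Computability.Cryptography.bitsVal`.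

/-- Bridge: `SIS.bitsToNat` (the `Nat.ofDigits` form) is the canonical little-endian value
`Literature.Computability.Complexity.bitsToNat` of `BoolEncodings.lean`. [folklore] -/
theorem bitsToNat_eq (l : List Bool) : bitsToNat l = Complexity.bitsToNat l := by
  induction l with
  | nil => rfl
  | cons b l ih =>
    rw [Complexity.bitsToNat_cons, ← ih]
    cases b <;> simp [bitsToNat, Nat.ofDigits_cons]

/-- Bridge: `SIS.bitsToNat` is `Literature.Computability.Cryptography.bitsVal` of `LiuPassWeakOWF.lean` (the same
recursion as `CplxCore.bitsToNat`). [folklore] -/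
theorem bitsToNat_eq_bitsVal (l : List Bool) : bitsToNat l = Cryptography.bitsVal l := by
  induction l with
  | nil => rfl
  | cons b l ih =>
    rw [Cryptography.bitsVal_cons, ← ih]
    cases b <;> simp [bitsToNat, Nat.ofDigits_cons]

/-- Round trip: `bitsToNat (natBits t v) = v` for `v < 2^t` (`bitsVal_natBits` through the
bridge). [folklore] -/
theorem bitsToNat_natBits {t v : ℕ} (hv : v < 2 ^ t) :
    bitsToNat (Cryptography.natBits t v) = v := by
  rw [bitsToNat_eq_bitsVal, Cryptography.bitsVal_natBits hv]


/-! ### Matrices as bit strings (the inverse of `parseMatrix`) -/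

/-- Chunk `p` of a concatenation of chunks of common length `t` (followed by anything) is
recovered by `drop (p t)` then `take t`. [folklore] -/
theorem take_drop_flatMap_of_length_eq {ι : Type*} (L : List ι) (f : ι → List Bool) (t : ℕ)
    (hf : ∀ i, (f i).length = t) (s : List Bool) {p : ℕ} (hp : p < L.length) :
    ((L.flatMap f ++ s).drop (p * t)).take t = f (L[p]) := by
  induction L generalizing p with
  | nil => simp at hp
  | cons a L ih =>
    rcases p with _ | p
    · simp only [List.flatMap_cons, List.append_assoc, zero_mul, List.drop_zero,
        List.getElem_cons_zero]
      exact List.take_left' (hf a)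
    · simp only [List.flatMap_cons, List.append_assoc, List.getElem_cons_succ]
      rw [Nat.succ_mul, Nat.add_comm, ← List.drop_drop, List.drop_left' (hf a)]
      exact ih (by simpa using hp)

/-- The row-major bit string of a matrix `A ∈ ℤ_q^{n×m}`, `t` bits per entry (binary
representative, little-endian): the format read by `parseMatrix`. [Goldreich 2001, §2.4.2;
Arora–Barak 2009, §0.1] [cite: AroraBarak2009, §0.1] -/
def matrixToBits {n m q : ℕ} (t : ℕ) (A : Matrix (Fin n) (Fin m) (ZMod q)) : List Bool :=
  (List.finRange (n * m)).flatMap fun idx => Cryptography.natBits t (A idx.divNat idx.modNat).val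

/-- `matrixToBits t A` has length `n m t`. [folklore] -/
@[simp] theorem length_matrixToBits {n m q : ℕ} (t : ℕ) (A : Matrix (Fin n) (Fin m) (ZMod q)) :
    (matrixToBits t A).length = n * m * t := by
  simp [matrixToBits, List.length_flatMap]

/-- **`parseMatrix` inverts `matrixToBits`**: parsing the bit string of `A ∈ ℤ_{2^t}^{n×m}`
(followed by anything) returns `A`. [Goldreich 2001, §2.4.2; Arora–Barak 2009, §0.1] [folklore] -/
theorem parseMatrix_matrixToBits_append {n m t : ℕ} (A : Matrix (Fin n) (Fin m) (ZMod (2 ^ t)))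
    (s : List Bool) : parseMatrix n m t (matrixToBits t A ++ s) = A := by
  haveI : NeZero (2 ^ t) := ⟨pow_ne_zero _ two_ne_zero⟩
  ext i j
  have hidx : (i : ℕ) * m + j < n * m := by
    have hi := i.2; have hj := j.2
    calc (i : ℕ) * m + j < i * m + m := by omega
      _ = (i + 1) * m := by ring
      _ ≤ n * m := Nat.mul_le_mul_right _ hi
  have hlen : (i : ℕ) * m + j < (List.finRange (n * m)).length := by simpa using hidx
  simp only [parseMatrix, Matrix.of_apply, matrixToBits]
  rw [take_drop_flatMap_of_length_eq _ _ t (fun _ => Cryptography.length_natBits _ _) s hlen,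
    List.getElem_finRange, bitsToNat_natBits (ZMod.val_lt _)]
  have he : (⟨(i : ℕ) * m + j, hidx⟩ : Fin (n * m)) = finProdFinEquiv (i, j) := by
    apply Fin.ext
    simp [finProdFinEquiv_apply_val]
    ring
  have hdm : ((⟨(i : ℕ) * m + j, hidx⟩ : Fin (n * m)).divNat, (⟨(i : ℕ) * m + j, hidx⟩ : Fin (n * m)).modNat)
      = (i, j) := by
    rw [← finProdFinEquiv_symm_apply, he, Equiv.symm_apply_apply]
  simp only [Prod.mk.injEq] at hdm
  rw [ZMod.natCast_zmod_val]
  exact congrArg₂ (fun a b => A a b) hdm.1 hdm.2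

/-- Hence `matrixToBits` is injective on `ℤ_{2^t}^{n×m}`. [folklore] -/
theorem matrixToBits_injective (n m t : ℕ) :
    Function.Injective (matrixToBits t : Matrix (Fin n) (Fin m) (ZMod (2 ^ t)) → List Bool) := by
  intro A B h
  rw [← parseMatrix_matrixToBits_append A [], ← parseMatrix_matrixToBits_append B [], h]

/-- The bit string of a matrix as a vector of length `n m t`. [folklore] -/
def matrixToVec {n m : ℕ} (t : ℕ) (A : Matrix (Fin n) (Fin m) (ZMod (2 ^ t))) :
    List.Vector Bool (n * m * t) :=
  ⟨matrixToBits t A, length_matrixToBits t A⟩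

/-- **Uniform bits give a uniform matrix**: `A ↦ matrixToBits t A` is a bijection
`ℤ_{2^t}^{n×m} ≃ {0,1}^{n m t}` (injective between sets of equal size `2^{n m t}`).
[Goldreich 2001, §2.4.2 (sampling an index from uniform coins)] [folklore] -/
theorem matrixToVec_bijective (n m t : ℕ) :
    Function.Bijective (matrixToVec t : Matrix (Fin n) (Fin m) (ZMod (2 ^ t)) → _) := by
  haveI : NeZero (2 ^ t) := ⟨pow_ne_zero _ two_ne_zero⟩
  rw [Fintype.bijective_iff_injective_and_card]
  refine ⟨fun A B h => matrixToBits_injective n m t (congrArg List.Vector.toList h), ?_⟩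
  rw [card_matrix, card_vector, Fintype.card_bool, ← pow_mul]
  ring_nf

/-! ### Parsing the vector part of an assembled input -/

/-- On an input `kb ++ (x ++ s)` with `|kb| = off`, `|x| = m`, `parseVec off m` reads exactly the
bits of `x` (as a `{0,1}`-vector, `boolVec`). [Ajtai 1996, Thm. 1; Goldreich 2001, §2.4.2] [folklore] -/
theorem parseVec_append (off m : ℕ) {kb : List Bool} (hkb : kb.length = off)
    (x : List.Vector Bool m) (s : List Bool) :
    parseVec off m (kb ++ (x.toList ++ s)) = boolVec x.get := by
  funext j
  have hj : (j : ℕ) < x.toList.length := by simp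
  simp only [parseVec, boolVec]
  rw [List.getD_append_right _ _ _ _ (by omega), show off + (j : ℕ) - kb.length = j by omega,
    List.getD_append _ _ _ _ hj, List.getD_eq_getElem _ _ hj]
  have hget : x.toList[(j : ℕ)] = x.get j := rfl
  rw [hget]
  cases x.get j <;> rfl


/-! ### Reading the SIS instance, syntactically

The solver must run on EVERY input string (its running time is at stake in
`sisSolver_polyTime`), so the instance code `encodeMatrix M = ⟨n, ⟨m, ⟨q, payload⟩⟩⟩` is read
by total syntactic functions — iterated applications of the pair decoder `boolUnpair` — which a
machine can mirror on all strings: the dimension is the length of the unary header of the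
`listBool` payload (`nOf`), and the key bits are the binary entry numerals of the doubly framed
payload, each padded/truncated to `t` bits (`keyOf`). On genuine instances these are `n` and
`matrixToBits t M` (`nOf_encodeMatrix`, `keyBitsWith_encodeMatrix`); nothing is claimed elsewhere. -/

/-- Iterated second component of the pair decoder (walking a framed list). [folklore] -/
def unpN : ℕ → List Bool → List Bool
  | 0, F => F
  | i + 1, F => unpN i (boolUnpair F).2

/-- The `i`-th item of a framed list (junk `[]` past its end). [folklore] -/
def itemAt (i : ℕ) (F : List Bool) : List Bool := (boolUnpair (unpN i F)).1

/-- The `listBool` payload of an instance code `⟨n, ⟨m, ⟨q, payload⟩⟩⟩`. [Micciancio–Regev 2007, Def. 5.3] [folklore] -/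
def payloadOf (inp : List Bool) : List Bool := (boolUnpair (boolUnpair (boolUnpair inp).2).2).2

/-- The dimension read off an instance code: the length of the unary header of the payload (on
`encodeMatrix M`, `M ∈ ℤ_q^{n×m}`, this is `n`). [folklore] -/
def nOf (inp : List Bool) : ℕ := (boolUnpair (payloadOf inp)).1.length

/-- A little-endian numeral padded with zeros, or truncated, to exactly `t` bits. [folklore] -/
def padTo (t : ℕ) (e : List Bool) : List Bool := (e ++ List.replicate t false).take t

/-- The code of entry `(i, j)`: item `j` of the framed entries of row item `i` of the payload. [folklore] -/
def entryCode (inp : List Bool) (i j : ℕ) : List Bool :=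
  itemAt j (boolUnpair (itemAt i (boolUnpair (payloadOf inp)).2)).2

/-- The key bits read off an instance code with parameters `(n, m, t)`: `n m` chunks of `t` bits,
row-major (the format of `matrixToBits`). [Goldreich 2001, §2.4.2; Arora–Barak 2009, §0.1] [folklore] -/
def keyBitsWith (n m t : ℕ) (inp : List Bool) : List Bool :=
  (List.range (n * m)).flatMap fun p => padTo t (entryCode inp (p / m) (p % m))

/-- The key bits of an instance code in the solver's parameters of its dimension. [folklore] -/
def keyOf (inp : List Bool) : List Bool := keyBitsWith (nOf inp) (width (nOf inp)) (bitWidth (nOf inp)) inp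

/-- `padTo t e` has length `t`. [folklore] -/
@[simp] theorem length_padTo (t : ℕ) (e : List Bool) : (padTo t e).length = t := by
  simp [padTo]

/-- `keyBitsWith n m t` produces `n m t` bits. [folklore] -/
@[simp] theorem length_keyBitsWith (n m t : ℕ) (inp : List Bool) : (keyBitsWith n m t inp).length = n * m * t := by
  simp [keyBitsWith, List.length_flatMap]

/-- Items of a framed list of codes. [folklore] -/
theorem itemAt_foldr : ∀ (l : List (List Bool)) (i : ℕ) (hi : i < l.length),
    itemAt i (l.foldr (fun a acc => boolPair a acc) []) = l[i]
  | [], i, hi => by simp at hi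
  | a :: l, 0, _ => by simp [itemAt, unpN]
  | a :: l, i + 1, hi => by
    have := itemAt_foldr l i (by simpa using hi)
    simpa [itemAt, unpN] using this

/-- Unfolding the code of a vector of naturals: unary length, then the framed binary numerals. [folklore] -/
theorem finVec_natBool_encode_eq {m : ℕ} (g : Fin m → ℕ) :
    (encodingFinVec encodingNatBool m).encode g =
      boolPair (unaryEncodeNat m) ((List.ofFn fun j => encodeNat (g j)).foldr (fun a acc => boolPair a acc) []) := by
  change boolPair (unaryEncodeNat (List.ofFn g).length)
    ((List.ofFn g).foldr (fun a acc => boolPair (encodingNatBool.encode a) acc) []) = _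
  rw [List.length_ofFn, ← List.foldr_map, List.map_ofFn]
  rfl

/-- The payload of a genuine instance. [folklore] -/
theorem payloadOf_encodeMatrix {n m q : ℕ} (A : Matrix (Fin n) (Fin m) (ZMod q)) :
    payloadOf (encodeMatrix A) =
      boolPair (unaryEncodeNat n) ((List.ofFn fun i : Fin n => (encodingFinVec encodingNatBool m).encode fun j => (A i j).val).foldr
        (fun a acc => boolPair a acc) []) := by
  simp only [payloadOf, encodeMatrix, boolUnpair_boolPair]
  change boolPair (unaryEncodeNat (List.ofFn fun i j => (A i j).val).length)
    ((List.ofFn fun i j => (A i j).val).foldr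
      (fun a acc => boolPair ((encodingFinVec encodingNatBool m).encode a) acc) []) = _
  rw [List.length_ofFn, ← List.foldr_map, List.map_ofFn]
  rfl

/-- **The dimension of a genuine instance.** [folklore] -/
theorem nOf_encodeMatrix {n m q : ℕ} (A : Matrix (Fin n) (Fin m) (ZMod q)) : nOf (encodeMatrix A) = n := by
  rw [nOf, payloadOf_encodeMatrix, boolUnpair_boolPair, MetaComplexity.length_unaryEncodeNat]

/-- The entry codes of a genuine instance are the binary numerals of the entries. [folklore] -/
theorem entryCode_encodeMatrix {n m q : ℕ} (A : Matrix (Fin n) (Fin m) (ZMod q)) (i : Fin n) (j : Fin m) :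
    entryCode (encodeMatrix A) i j = encodeNat (A i j).val := by
  rw [entryCode, payloadOf_encodeMatrix, boolUnpair_boolPair, itemAt_foldr _ _ (by simp), List.getElem_ofFn,
    finVec_natBool_encode_eq, boolUnpair_boolPair, itemAt_foldr _ _ (by simp), List.getElem_ofFn]

/-- Binary numerals end with a `1`. [folklore] -/
theorem encodePosNum_eq_append_true : ∀ p : PosNum, ∃ l, encodePosNum p = l ++ [true]
  | PosNum.one => ⟨[], rfl⟩
  | PosNum.bit0 p => by
    obtain ⟨l, hl⟩ := encodePosNum_eq_append_true p
    exact ⟨false :: l, by simp [encodePosNum, hl]⟩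
  | PosNum.bit1 p => by
    obtain ⟨l, hl⟩ := encodePosNum_eq_append_true p
    exact ⟨true :: l, by simp [encodePosNum, hl]⟩

/-- A positive numeral is at least `2^{length - 1}`. [folklore] -/
theorem two_pow_length_pred_le {v : ℕ} (hv : v ≠ 0) : 2 ^ ((encodeNat v).length - 1) ≤ v := by
  have hcast : ((v : Num) : ℕ) = v := Num.to_of_nat v
  cases hn : (v : Num) with
  | zero => rw [hn] at hcast; exact absurd hcast.symm (by simpa using hv)
  | pos p =>
    obtain ⟨l, hl⟩ := encodePosNum_eq_append_true p
    have he : encodeNat v = l ++ [true] := by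
      change encodeNum (v : Num) = _; rw [hn]; exact hl
    have hval := Complexity.bitsToNat_encodeNat v
    rw [he, Complexity.bitsToNat_append] at hval
    rw [he]
    simp only [List.length_append, List.length_singleton, Nat.add_sub_cancel]
    simp [Complexity.bitsToNat] at hval
    omega

/-- Numerals below `2^t` have at most `t` bits. [folklore] -/
theorem length_encodeNat_le_of_lt {v t : ℕ} (hv : v < 2 ^ t) : (encodeNat v).length ≤ t := by
  by_cases h0 : v = 0
  · subst h0; exact Nat.zero_le _
  · have h1 := two_pow_length_pred_le h0
    have h2 : 2 ^ ((encodeNat v).length - 1) < 2 ^ t := lt_of_le_of_lt h1 hv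
    have h3 := (Nat.pow_lt_pow_iff_right (by norm_num)).1 h2
    have h4 : (encodeNat v).length ≠ 0 := by
      intro h; apply h0
      have := Complexity.bitsToNat_encodeNat v
      rw [List.length_eq_zero_iff.1 h] at this
      simpa using this.symm
    omega

-- Twin of `Literature.CplxCore.eq_of_bitsToNat_eq` (Complexity/KannanLanguage.lean), whose import closure is not wanted
-- here; proper home: `BoolEncodings.lean` (librarian item).
/-- Bit strings of equal length and equal value are equal. [folklore] -/
theorem eq_of_bitsToNat_eq : ∀ {v w : List Bool}, v.length = w.length → Complexity.bitsToNat v = Complexity.bitsToNat w → v = w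
  | [], [], _, _ => rfl
  | [], _ :: _, h, _ => by simp at h
  | _ :: _, [], h, _ => by simp at h
  | b :: v, c :: w, h, hval => by
    simp only [List.length_cons, Nat.succ.injEq] at h
    rw [Complexity.bitsToNat_cons, Complexity.bitsToNat_cons] at hval
    have hb : b = c := by
      have := congrArg (· % 2) hval
      cases b <;> cases c <;> simp [Nat.add_mod] at this ⊢
    subst hb
    rw [eq_of_bitsToNat_eq h (by omega)]

/-- **Padding a numeral to `t` bits is its `t`-bit little-endian field** (for values `< 2^t`).
[folklore] -/
theorem padTo_encodeNat {t v : ℕ} (hv : v < 2 ^ t) : padTo t (encodeNat v) = Cryptography.natBits t v := by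
  have hlen := length_encodeNat_le_of_lt hv
  have hpad : padTo t (encodeNat v) = encodeNat v ++ List.replicate (t - (encodeNat v).length) false := by
    rw [padTo, List.take_append, List.take_of_length_le hlen, List.take_replicate, min_eq_left (Nat.sub_le _ _)]
  apply eq_of_bitsToNat_eq
  · simp
  · rw [hpad, ← bitsToNat_eq, ← bitsToNat_eq, bitsToNat_natBits hv, bitsToNat_eq,
      Complexity.bitsToNat_append, Complexity.bitsToNat_replicate_false, Complexity.bitsToNat_encodeNat]
    simp

/-- Lists cut into `N` chunks of length `t` that agree chunkwise are equal. [folklore] -/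
theorem eq_of_chunks_eq (t : ℕ) : ∀ (N : ℕ) (L₁ L₂ : List Bool), L₁.length = N * t → L₂.length = N * t →
    (∀ p < N, (L₁.drop (p * t)).take t = (L₂.drop (p * t)).take t) → L₁ = L₂
  | 0, L₁, L₂, h₁, h₂, _ => by
    have e₁ : L₁ = [] := List.length_eq_zero_iff.1 (by simpa using h₁)
    have e₂ : L₂ = [] := List.length_eq_zero_iff.1 (by simpa using h₂)
    rw [e₁, e₂]
  | N + 1, L₁, L₂, h₁, h₂, h => by
    have h0 := h 0 (Nat.succ_pos N)
    simp only [zero_mul, List.drop_zero] at h0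
    rw [← List.take_append_drop t L₁, ← List.take_append_drop t L₂, h0]
    congr 1
    refine eq_of_chunks_eq t N _ _ (by rw [List.length_drop, h₁, Nat.succ_mul]; omega)
      (by rw [List.length_drop, h₂, Nat.succ_mul]; omega) fun p hp => ?_
    have := h (p + 1) (by omega)
    rwa [Nat.succ_mul, Nat.add_comm, ← List.drop_drop, ← List.drop_drop] at this

/-- `modulus n = 2 ^ bitWidth n`. [folklore] -/
theorem modulus_eq' (n : ℕ) : modulus n = 2 ^ bitWidth n := rfl

/-- **The key bits of a genuine instance are `matrixToBits`.** [Goldreich 2001, §2.4.2] [folklore] -/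
theorem keyBitsWith_encodeMatrix {n m t : ℕ} (A : Matrix (Fin n) (Fin m) (ZMod (2 ^ t))) :
    keyBitsWith n m t (encodeMatrix A) = matrixToBits t A := by
  refine eq_of_chunks_eq t (n * m) _ _ (length_keyBitsWith _ _ _ _) (length_matrixToBits _ _) fun p hp => ?_
  have hm : 0 < m := Nat.pos_of_ne_zero fun h => by subst h; simp at hp
  have hi : p / m < n := (Nat.div_lt_iff_lt_mul hm).2 hp
  have hj : p % m < m := Nat.mod_lt _ hm
  -- chunk `p` of the syntactic key
  have h1 : ((keyBitsWith n m t (encodeMatrix A)).drop (p * t)).take t = padTo t (entryCode (encodeMatrix A) (p / m) (p % m)) := by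
    have := take_drop_flatMap_of_length_eq (List.range (n * m))
      (fun p => padTo t (entryCode (encodeMatrix A) (p / m) (p % m))) t (fun _ => length_padTo _ _) [] (p := p) (by simpa using hp)
    simpa [keyBitsWith] using this
  -- chunk `p` of `matrixToBits`
  have h2 : ((matrixToBits t A).drop (p * t)).take t = Cryptography.natBits t (A ⟨p / m, hi⟩ ⟨p % m, hj⟩).val := by
    have := take_drop_flatMap_of_length_eq (List.finRange (n * m))
      (fun idx : Fin (n * m) => Cryptography.natBits t (A idx.divNat idx.modNat).val) t
      (fun _ => Cryptography.length_natBits _ _) [] (p := p) (by simpa using hp)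
    simp only [List.append_nil, List.getElem_finRange] at this
    rw [matrixToBits, this]
    rfl
  rw [h1, h2, show entryCode (encodeMatrix A) (p / m) (p % m) =
      entryCode (encodeMatrix A) ((⟨p / m, hi⟩ : Fin n) : ℕ) ((⟨p % m, hj⟩ : Fin m) : ℕ) from rfl,
    entryCode_encodeMatrix, padTo_encodeNat (ZMod.val_lt _)]

/-! ### Blocks of security parameters and the length guess -/

/-- The number of input lengths `k` with `dimOf k = n`: `blockLen n = keyLen (n+1) - keyLen n`
(`SIS.dimOf_eq_iff`). [Goldreich 2001, §2.4.1] [cite: Goldreich2001, §2.4.1] -/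
def blockLen (n : ℕ) : ℕ := keyLen (n + 1) - keyLen n

/-- Blocks are nonempty: `1 ≤ blockLen n`. [folklore] -/
theorem one_le_blockLen (n : ℕ) : 1 ≤ blockLen n := by
  have := keyLen_strictMono (Nat.lt_add_one n)
  unfold blockLen; omega

/-- `blockLen n ≤ keyLen (n + 1)`. [folklore] -/
theorem blockLen_le (n : ℕ) : blockLen n ≤ keyLen (n + 1) := Nat.sub_le _ _

/-- The number of coins used to guess a length in the block: `guessBits n = ⌊log₂ blockLen n⌋ + 1`,
so that `blockLen n < 2^{guessBits n} ≤ 2 blockLen n`. [Goldreich 2001, §2.4.1] [folklore] -/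
def guessBits (n : ℕ) : ℕ := Nat.log 2 (blockLen n) + 1

/-- `blockLen n < 2 ^ guessBits n`. [Mathlib `Nat.lt_pow_succ_log_self`] [folklore] -/
theorem blockLen_lt_two_pow_guessBits (n : ℕ) : blockLen n < 2 ^ guessBits n :=
  Nat.lt_pow_succ_log_self one_lt_two _

/-- `2 ^ guessBits n ≤ 2 blockLen n`. [Mathlib `Nat.pow_log_le_self`] [folklore] -/
theorem two_pow_guessBits_le (n : ℕ) : 2 ^ guessBits n ≤ 2 * blockLen n := by
  have := Nat.pow_log_le_self 2 (x := blockLen n) (by have := one_le_blockLen n; omega)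
  unfold guessBits
  rw [pow_succ]
  omega

/-! ### Length bounds (for the coin budget) -/

-- `length_encode_listBool`, `length_encodeNat_le`, `length_unaryEncodeNat`: generic encoding-length
-- lemmas of `Literature.CplxCore` (currently housed in `MetaComplexity/FregeProofs.lean`).

/-- A bound for the code of a vector of naturals below `q`: `2 d + 2 + d (2 q + 2)`. [folklore] -/
theorem length_encodingFinVec_nat_le {d q : ℕ} (v : Fin d → ℕ) (hv : ∀ i, v i < q) :
    ((encodingFinVec encodingNatBool d).encode v).length ≤ 2 * d + 2 + d * (2 * q + 2) := by
  change (encodingNatBool.listBool.encode (List.ofFn v)).length ≤ _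
  rw [length_encode_listBool, List.length_ofFn]
  gcongr
  have : ∀ a ∈ List.ofFn v, 2 * (encodingNatBool.encode a).length + 2 ≤ 2 * q + 2 := by
    intro a ha
    rw [List.mem_ofFn] at ha
    obtain ⟨i, rfl⟩ := ha
    have h1 := length_encodeNat_le (v i)
    have h2 := hv i
    change 2 * (encodeNat (v i)).length + 2 ≤ _
    omega
  calc ((List.ofFn v).map fun a => 2 * (encodingNatBool.encode a).length + 2).sum
      ≤ ((List.ofFn v).map fun _ => 2 * q + 2).sum := List.sum_le_sum (fun a ha => this a ha)
    _ = d * (2 * q + 2) := by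
        simp [Function.comp_def, List.ofFn_const, List.sum_replicate]

/-- Bound for `encodeResidues` on `ℤ_qⁿ`: `resBound n q = 2 n + 2 + n (2 q + 2)`. [folklore] -/
def resBound (n q : ℕ) : ℕ := 2 * n + 2 + n * (2 * q + 2)

/-- `|encodeResidues v| ≤ resBound n q`. [folklore] -/
theorem length_encodeResidues_le {n q : ℕ} [NeZero q] (v : Fin n → ZMod q) :
    (encodeResidues v).length ≤ resBound n q :=
  length_encodingFinVec_nat_le _ fun i => ZMod.val_lt (v i)

/-- Bound for `encodeMatrix` on `ℤ_q^{n×m}`: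
`matBound n m q = 2 n + 2 m + 2 q + 6 + (2 n + 2 + n (2 (2 m + 2 + m (2 q + 2)) + 2))`. [folklore] -/
def matBound (n m q : ℕ) : ℕ :=
  2 * n + 2 + (2 * m + 2 + (2 * q + 2 + (2 * n + 2 + n * (2 * (2 * m + 2 + m * (2 * q + 2)) + 2))))

/-- `|encodeMatrix A| ≤ matBound n m q`. [folklore] -/
theorem length_encodeMatrix_le {n m q : ℕ} [NeZero q] (A : Matrix (Fin n) (Fin m) (ZMod q)) :
    (encodeMatrix A).length ≤ matBound n m q := by
  unfold encodeMatrix matBound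
  simp only [length_boolPair]
  have hn := length_encodeNat_le n
  have hm := length_encodeNat_le m
  have hq := length_encodeNat_le q
  have hp : ((encodingFinVec (encodingFinVec encodingNatBool m) n).encode fun i j => (A i j).val).length
      ≤ 2 * n + 2 + n * (2 * (2 * m + 2 + m * (2 * q + 2)) + 2) := by
    change ((encodingFinVec encodingNatBool m).listBool.encode (List.ofFn fun i j => (A i j).val)).length ≤ _
    rw [length_encode_listBool, List.length_ofFn]
    gcongr
    have hrow : ∀ a ∈ List.ofFn (fun i j => (A i j).val),
        2 * ((encodingFinVec encodingNatBool m).encode a).length + 2 ≤ 2 * (2 * m + 2 + m * (2 * q + 2)) + 2 := by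
      intro a ha
      rw [List.mem_ofFn] at ha
      obtain ⟨i, rfl⟩ := ha
      have := length_encodingFinVec_nat_le (fun j => (A i j).val) fun j => ZMod.val_lt (A i j)
      omega
    calc ((List.ofFn fun i j => (A i j).val).map fun a =>
            2 * ((encodingFinVec encodingNatBool m).encode a).length + 2).sum
        ≤ ((List.ofFn fun i j => (A i j).val).map fun _ => 2 * (2 * m + 2 + m * (2 * q + 2)) + 2).sum :=
          List.sum_le_sum (fun a ha => hrow a ha)
      _ = n * (2 * (2 * m + 2 + m * (2 * q + 2)) + 2) := by
          simp [Function.comp_def, List.ofFn_const, List.sum_replicate]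
  omega


/-! ### The solver -/

/-- The parsed `{0,1}`-vector of an input of dimension `n` (offset `n m t`, length `m`). [Ajtai
1996, Thm. 1] [folklore] -/
def xOf (n : ℕ) (w : List Bool) : Fin (width n) → ℤ :=
  parseVec (n * width n * bitWidth n) (width n) w

/-- The inverter's challenge assembled by the solver: key bits of `M`, then the `x`-bits, then
the padding. [Goldreich 2001, §2.4.2] [folklore] -/
def query (n : ℕ) (M : Matrix (Fin n) (Fin (width n)) (ZMod (modulus n))) (xs pad : List Bool) :
    List Bool :=
  matrixToBits (bitWidth n) M ++ (xs ++ pad)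

/-- A bound on the length of the inverter's input `boolPair (1^{|w|}) (sisFunction w)` for
queries `w` in the block of `n`. [folklore] -/
def inpBound (n : ℕ) : ℕ :=
  2 * keyLen (n + 1) + 2 + (2 * matBound n (width n) (modulus n) + 2 +
    (2 * resBound n (modulus n) + 2 + keyLen (n + 1)))

/-- A common bound for the coin-count guesses in dimension `n`: `cbMax cb n = max_{ℓ ≤ inpBound n} cb ℓ`
(a `Finset.sup` over the nonempty range `[0, inpBound n]`). [folklore] -/
def cbMax (cb : ℕ → ℕ) (n : ℕ) : ℕ := (Finset.range (inpBound n + 1)).sup cb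

/-- The number of coins used to guess the inverter's coin count: `lenBits cb n = ⌊log₂ (cbMax + 1)⌋ + 1`,
so that every `cb ℓ`, `ℓ ≤ inpBound n`, is `< 2^{lenBits cb n} ≤ 2 (cbMax cb n + 1)`. (The inverter's
coin budget `A.coinLen` is only known to be BOUNDED by a polynomial `cb`; the solver guesses the
exact count uniformly below `cb ℓ + 1`, at a polynomial loss.) [Goldreich 2001, §1.3.2] [folklore] -/
def lenBits (cb : ℕ → ℕ) (n : ℕ) : ℕ := Nat.log 2 (cbMax cb n + 1) + 1

/-- `cb ℓ < 2 ^ lenBits cb n` for `ℓ ≤ inpBound n`. [folklore] -/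
theorem lt_two_pow_lenBits {cb : ℕ → ℕ} {n ℓ : ℕ} (hℓ : ℓ ≤ inpBound n) : cb ℓ < 2 ^ lenBits cb n := by
  have h1 : cb ℓ ≤ cbMax cb n := Finset.le_sup (f := cb) (Finset.mem_range.2 (Nat.lt_succ_of_le hℓ))
  have h2 : cbMax cb n + 1 < 2 ^ lenBits cb n := Nat.lt_pow_succ_log_self one_lt_two _
  omega

/-- `2 ^ lenBits cb n ≤ 2 (cbMax cb n + 1)`. [folklore] -/
theorem two_pow_lenBits_le (cb : ℕ → ℕ) (n : ℕ) : 2 ^ lenBits cb n ≤ 2 * (cbMax cb n + 1) := by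
  have := Nat.pow_log_le_self 2 (x := cbMax cb n + 1) (by omega)
  unfold lenBits
  rw [pow_succ]
  omega

/-- For a monotone bound the maximum over the block is attained at its end. [folklore] -/
theorem cbMax_eq_of_monotone {cb : ℕ → ℕ} (hcb : Monotone cb) (n : ℕ) : cbMax cb n = cb (inpBound n) := by
  refine le_antisymm (Finset.sup_le fun ℓ hℓ => hcb (Nat.lt_succ_iff.1 (Finset.mem_range.1 hℓ))) ?_
  exact Finset.le_sup (f := cb) (Finset.mem_range.2 (Nat.lt_succ_self _))

/-- The coins the solver needs in dimension `n`: `guessBits n` for the length guess, `width n`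
for `x`, `blockLen n` for the padding, `lenBits cb n` for the coin-count guess, and enough for one
run of the inverter on any input of length `≤ inpBound n`. [folklore] -/
def coinBudget (A : RandAlg (List Bool) (List Bool)) (cb : ℕ → ℕ) (n : ℕ) : ℕ :=
  guessBits n + width n + blockLen n + lenBits cb n + (Finset.range (inpBound n + 1)).sup A.coinLen

/-- The solver at a known dimension `n` on a known key `M` with coins `r`: guess
`u < blockLen n` from the first `guessBits n` coins, take `x ∈ {0,1}^m` and `u` padding bits from
the next coins, form the query `w = (M, x, pad)` and the inverter's input
`y = (1^{|w|}, sisFunction w)`, guess the inverter's coin count `L ≤ cb |y|` from the next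
`lenBits cb n` coins, run the inverter `A` on `y` with the next `L` coins, parse `x'` from its
answer and output the code of `x - x'`.
[Micciancio–Regev 2007, §5.1 (p. 18); Ajtai 1996, Thm. 1; Goldreich 2001, §2.4.2] [cite: MicciancioRegev2007, §5.1] -/
def solverCore (A : RandAlg (List Bool) (List Bool)) (cb : ℕ → ℕ) (n : ℕ)
    (M : Matrix (Fin n) (Fin (width n)) (ZMod (modulus n))) (r : List Bool) : List Bool :=
  let u := bitsToNat (r.take (guessBits n)) % blockLen n
  let w := query n M ((r.drop (guessBits n)).take (width n))
    ((r.drop (guessBits n + width n)).take u)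
  let y := boolPair (unaryEncodeNat w.length) (sisFunction w)
  let L := bitsToNat ((r.drop (guessBits n + width n + blockLen n)).take (lenBits cb n)) % (cb y.length + 1)
  let z := A.run y ((r.drop (guessBits n + width n + blockLen n + lenBits cb n)).take L)
  encodeIntVec ⟨width n, xOf n w - xOf n z⟩

/-- The instance is longer than its dimension: `n ≤ |encodeMatrix M|`. [folklore] -/
theorem le_length_encodeMatrix {n m q : ℕ} (M : Matrix (Fin n) (Fin m) (ZMod q)) :
    n ≤ (encodeMatrix M).length := by
  unfold encodeMatrix
  simp only [length_boolPair]
  have : 2 * n + 2 ≤ ((encodingFinVec (encodingFinVec encodingNatBool m) n).encode fun i j => (M i j).val).length := by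
    change 2 * n + 2 ≤ ((encodingFinVec encodingNatBool m).listBool.encode (List.ofFn fun i j => (M i j).val)).length
    rw [length_encode_listBool, List.length_ofFn]
    omega
  omega

/-- The solver at a known dimension `n` on known key bits `key` with coins `r` (see `solverCore`,
which is the case `key = matrixToBits t M`). [Micciancio–Regev 2007, §5.1 (p. 18); Ajtai 1996, Thm. 1; Goldreich 2001, §2.4.2] [cite: MicciancioRegev2007, §5.1] -/
def solverCoreK (A : RandAlg (List Bool) (List Bool)) (cb : ℕ → ℕ) (n : ℕ) (key : List Bool) (r : List Bool) : List Bool :=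
  let u := bitsToNat (r.take (guessBits n)) % blockLen n
  let w := key ++ (((r.drop (guessBits n)).take (width n)) ++ ((r.drop (guessBits n + width n)).take u))
  let y := boolPair (unaryEncodeNat w.length) (sisFunction w)
  let L := bitsToNat ((r.drop (guessBits n + width n + blockLen n)).take (lenBits cb n)) % (cb y.length + 1)
  let z := A.run y ((r.drop (guessBits n + width n + blockLen n + lenBits cb n)).take L)
  encodeIntVec ⟨width n, xOf n w - xOf n z⟩

/-- `solverCore` is `solverCoreK` on the key bits of the matrix (definitional). [folklore] -/
theorem solverCore_eq_solverCoreK (A : RandAlg (List Bool) (List Bool)) (cb : ℕ → ℕ) (n : ℕ)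
    (M : Matrix (Fin n) (Fin (width n)) (ZMod (modulus n))) (r : List Bool) :
    solverCore A cb n M r = solverCoreK A cb n (matrixToBits (bitWidth n) M) r := rfl

/-- **The SIS′ solver built from an inverter `A` of Ajtai's function** (the reduction behind
"inverting `sisFunction` ⇒ solving SIS′ on the average"), relative to a bound `cb` for the
inverter's coin budget: read the dimension `n` and the key bits off the input syntactically
(`nOf`, `keyOf`: on an instance `encodeMatrix M`, `M ∈ ℤ_{q(n)}^{n×m(n)}`, these are `n` and
`matrixToBits t M`, so that the run is `solverCore A cb n M`, `sisSolver_run_encodeMatrix`; on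
other strings whatever the parser makes of them, every intermediate string staying polynomially
long since `nOf inp ≤ |inp|`) and run `solverCoreK`; the coin budget at input length `N` covers
every dimension `n ≤ N`.
[Micciancio–Regev 2007, §5.1 (p. 18); Ajtai 1996, Thm. 1; Goldreich 2001, §2.4.2] [cite: MicciancioRegev2007, §5.1] -/
def sisSolver (A : RandAlg (List Bool) (List Bool)) (cb : ℕ → ℕ) : RandAlg (List Bool) (List Bool) where
  run inp r := solverCoreK A cb (nOf inp) (keyOf inp) r
  coinLen N := (Finset.range (N + 1)).sup (coinBudget A cb)

/-- On a genuine instance the solver runs `solverCore` at the true dimension and key. [folklore] -/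
theorem sisSolver_run_encodeMatrix (A : RandAlg (List Bool) (List Bool)) (cb : ℕ → ℕ) {n : ℕ}
    (M : Matrix (Fin n) (Fin (width n)) (ZMod (modulus n))) (r : List Bool) :
    (sisSolver A cb).run (encodeMatrix M) r = solverCore A cb n M r := by
  change solverCoreK A cb (nOf (encodeMatrix M)) (keyOf (encodeMatrix M)) r = _
  rw [keyOf, nOf_encodeMatrix, solverCore_eq_solverCoreK]
  congr 1
  exact keyBitsWith_encodeMatrix (t := bitWidth n) M

/-- Length of a query: `|query n M xs pad| = n m t + |xs| + |pad|`. [folklore] -/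
@[simp] theorem length_query {n : ℕ} (M : Matrix (Fin n) (Fin (width n)) (ZMod (modulus n)))
    (xs pad : List Bool) : (query n M xs pad).length = n * width n * bitWidth n + xs.length + pad.length := by
  simp [query, Nat.add_assoc]

/-- The key parsed from a query is the key. [folklore] -/
theorem parseMatrix_query {n : ℕ} (M : Matrix (Fin n) (Fin (width n)) (ZMod (modulus n)))
    (xs pad : List Bool) : parseMatrix n (width n) (bitWidth n) (query n M xs pad) = M :=
  parseMatrix_matrixToBits_append M _

/-- The vector parsed from a query is its `x`-part. [folklore] -/
theorem xOf_query {n : ℕ} (M : Matrix (Fin n) (Fin (width n)) (ZMod (modulus n)))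
    (x : List.Vector Bool (width n)) (pad : List Bool) : xOf n (query n M x.toList pad) = boolVec x.get :=
  parseVec_append _ _ (length_matrixToBits _ M) x pad

/-- **Correctness of the solver's output.** If the inverter's answer `z` is a preimage of
`sisFunction w` for the query `w = (M, x, pad)` (in the block of `n`) whose parsed vector differs
from `x`, then `x - x'` is an SIS′ solution for `M` within the norm bound `β = normBound n`
(collision ⇒ short vector with an odd coordinate, `SIS.isSolution'_sub_of_collision`, and
`√m ≤ β`). [Micciancio–Regev 2007, §5.1 (p. 18); Ajtai 1996, Thm. 1] [cite: MicciancioRegev2007, §5.1] -/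
theorem isSolution'_of_answer {n : ℕ} (M : Matrix (Fin n) (Fin (width n)) (ZMod (modulus n)))
    (xs pad : List Bool) (hk : dimOf (query n M xs pad).length = n) {z : List Bool}
    (hz : sisFunction z = sisFunction (query n M xs pad)) (hne : xOf n z ≠ xOf n (query n M xs pad)) :
    IsSolution' M (normBound n) (xOf n (query n M xs pad) - xOf n z) := by
  have hl := length_eq_of_sisFunction_eq hz
  rw [sisFunction_eq, sisFunction_eq, hl, hk] at hz
  obtain ⟨-, hv, -⟩ := sisFunctionWith_eq_iff.1 hz
  rw [parseMatrix_query] at hv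
  exact (isSolution'_sub_of_collision (inBox_parseVec _ _ _) (inBox_parseVec _ _ z) hne.symm
    hv.symm).mono (sqrt_width_le_normBound n)


/-! ### Analysis I: what the solver does on decomposed coins -/

/-- The inverter's input for the query `w`: `(1^{|w|}, sisFunction w)`. [Goldreich 2001,
Def. 2.2.1] [folklore] -/
def inpOf (w : List Bool) : List Bool := boolPair (unaryEncodeNat w.length) (sisFunction w)

/-- The inverter's answer on query `w` when the coin-count guess is read from `r5` and the coins
from the supply `r4`: `A` is run on `inpOf w` with the first `L` coins of `r4`,
`L = bitsToNat r5 mod (cb |inpOf w| + 1)`. [folklore] -/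
def answer (A : RandAlg (List Bool) (List Bool)) (cb : ℕ → ℕ) (w r5 r4 : List Bool) : List Bool :=
  A.run (inpOf w) (r4.take (bitsToNat r5 % (cb (inpOf w).length + 1)))

/-- **The solver on decomposed coins.** With coins `r1 ++ x ++ r3 ++ r5 ++ r4` (`|r1| = guessBits n`,
`|x| = width n`, `|r3| = blockLen n`, `|r5| = lenBits cb n`) whose first block guesses the padding
length `p`, the solver queries `w = (M, x, r3↾p)` and outputs the code of `x - x'`, `x'` parsed
from the inverter's answer. [folklore] -/
theorem solverCore_append (A : RandAlg (List Bool) (List Bool)) (cb : ℕ → ℕ) {n : ℕ}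
    (M : Matrix (Fin n) (Fin (width n)) (ZMod (modulus n))) (r1 : List.Vector Bool (guessBits n))
    (x : List.Vector Bool (width n)) (r3 : List.Vector Bool (blockLen n))
    (r5 : List.Vector Bool (lenBits cb n)) (r4 : List Bool) {p : ℕ}
    (hu : bitsToNat r1.toList % blockLen n = p) :
    solverCore A cb n M (r1.toList ++ (x.toList ++ (r3.toList ++ (r5.toList ++ r4)))) =
      encodeIntVec ⟨width n, xOf n (query n M x.toList (r3.toList.take p)) -
        xOf n (answer A cb (query n M x.toList (r3.toList.take p)) r5.toList r4)⟩ := by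
  have hp : p ≤ blockLen n := by rw [← hu]; exact (Nat.mod_lt _ (one_le_blockLen n)).le
  have e1 : (r1.toList ++ (x.toList ++ (r3.toList ++ (r5.toList ++ r4)))).take (guessBits n) = r1.toList :=
    List.take_left' r1.toList_length
  have e2 : (r1.toList ++ (x.toList ++ (r3.toList ++ (r5.toList ++ r4)))).drop (guessBits n) =
      x.toList ++ (r3.toList ++ (r5.toList ++ r4)) := List.drop_left' r1.toList_length
  have e3 : (x.toList ++ (r3.toList ++ (r5.toList ++ r4))).take (width n) = x.toList :=
    List.take_left' x.toList_length
  have e4 : (r1.toList ++ (x.toList ++ (r3.toList ++ (r5.toList ++ r4)))).drop (guessBits n + width n) =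
      r3.toList ++ (r5.toList ++ r4) := by
    rw [← List.drop_drop, e2, List.drop_left' x.toList_length]
  have e5 : (r3.toList ++ (r5.toList ++ r4)).take p = r3.toList.take p :=
    List.take_append_of_le_length (by simpa using hp)
  have e6 : (r1.toList ++ (x.toList ++ (r3.toList ++ (r5.toList ++ r4)))).drop
      (guessBits n + width n + blockLen n) = r5.toList ++ r4 := by
    rw [← List.drop_drop, e4, List.drop_left' r3.toList_length]
  have e7 : (r5.toList ++ r4).take (lenBits cb n) = r5.toList := List.take_left' r5.toList_length
  have e8 : (r1.toList ++ (x.toList ++ (r3.toList ++ (r5.toList ++ r4)))).drop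
      (guessBits n + width n + blockLen n + lenBits cb n) = r4 := by
    rw [← List.drop_drop, e6, List.drop_left' r5.toList_length]
  simp only [solverCore, e1, hu, e2, e3, e4, e5, e6, e7, e8, answer, inpOf]

/-- **When the solver succeeds.** If the guessed padding length is `p`, the query lies in the
block of `n`, and the inverter's answer is a preimage whose parsed vector differs from `x`, then
the solver's output on the instance `encodeMatrix M` decodes to an SIS′ solution.
[Micciancio–Regev 2007, §5.1 (p. 18); Ajtai 1996, Thm. 1] [cite: MicciancioRegev2007, §5.1] -/
theorem sisSolver_success (A : RandAlg (List Bool) (List Bool)) (cb : ℕ → ℕ) {n : ℕ}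
    (M : Matrix (Fin n) (Fin (width n)) (ZMod (modulus n))) (r1 : List.Vector Bool (guessBits n))
    (x : List.Vector Bool (width n)) (r3 : List.Vector Bool (blockLen n))
    (r5 : List.Vector Bool (lenBits cb n)) (r4 : List Bool) {p : ℕ}
    (hu : bitsToNat r1.toList % blockLen n = p)
    (hk : dimOf (query n M x.toList (r3.toList.take p)).length = n)
    (hz : sisFunction (answer A cb (query n M x.toList (r3.toList.take p)) r5.toList r4) =
      sisFunction (query n M x.toList (r3.toList.take p)))
    (hne : xOf n (answer A cb (query n M x.toList (r3.toList.take p)) r5.toList r4) ≠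
      xOf n (query n M x.toList (r3.toList.take p))) :
    IsSolution' M (normBound n)
      (decodeIntVec (width n) ((sisSolver A cb).run (encodeMatrix M)
        (r1.toList ++ (x.toList ++ (r3.toList ++ (r5.toList ++ r4)))))) := by
  rw [sisSolver_run_encodeMatrix, solverCore_append A cb M r1 x r3 r5 r4 hu, decodeIntVec_encodeIntVec]
  exact isSolution'_of_answer M _ _ hk hz hne

/-! ### Analysis II: the inverter's view of a query -/

/-- `modulus n = 2 ^ bitWidth n` (definitional; used to align implicit moduli). [folklore] -/
theorem modulus_eq (n : ℕ) : modulus n = 2 ^ bitWidth n := rfl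

/-- The padding of a query with `|xs| = width n` is recovered by dropping `n m t + m` bits. [folklore] -/
theorem drop_query {n : ℕ} (M : Matrix (Fin n) (Fin (width n)) (ZMod (modulus n)))
    (x : List.Vector Bool (width n)) (pad : List Bool) :
    (query n M x.toList pad).drop (n * width n * bitWidth n + width n) = pad := by
  unfold query
  rw [← List.drop_drop, List.drop_left' (length_matrixToBits _ M), List.drop_left' x.toList_length]

/-- **What the inverter sees.** For a query `w = (M, x, pad)` in the block of `n`, the
inverter's input is `(1^{|w|}, ⟨encodeMatrix M, ⟨encodeResidues (M x mod q), pad⟩⟩)`: it depends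
on `x` only through the image `f_M(x)`. [Ajtai 1996, Thm. 1; Goldreich 2001, §2.4.2] [folklore] -/
theorem inpOf_query {n : ℕ} (M : Matrix (Fin n) (Fin (width n)) (ZMod (modulus n)))
    (x : List.Vector Bool (width n)) (pad : List Bool) (hk : dimOf (query n M x.toList pad).length = n) :
    inpOf (query n M x.toList pad) =
      boolPair (unaryEncodeNat (query n M x.toList pad).length)
        (boolPair (encodeMatrix M)
          (boolPair (encodeResidues (hashFun M (xOf n (query n M x.toList pad)))) pad)) := by
  unfold inpOf
  rw [sisFunction_eq, hk]
  unfold sisFunctionWith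
  rw [parseMatrix_query, drop_query]
  rfl

/-- Length bound for the inverter's input on queries in the block of `n`. [folklore] -/
theorem length_inpOf_query_le {n : ℕ} (M : Matrix (Fin n) (Fin (width n)) (ZMod (modulus n)))
    (x : List.Vector Bool (width n)) {pad : List Bool} (hpad : pad.length < blockLen n)
    (hk : dimOf (query n M x.toList pad).length = n) :
    (inpOf (query n M x.toList pad)).length ≤ inpBound n := by
  have hw : (query n M x.toList pad).length < keyLen (n + 1) := by
    rw [length_query, x.toList_length]
    unfold blockLen at hpad
    have := keyLen_strictMono (Nat.lt_add_one n)
    unfold keyLen at this hpad ⊢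
    omega
  rw [inpOf_query M x pad hk]
  simp only [length_boolPair]
  have h1 := MetaComplexity.length_unaryEncodeNat (query n M x.toList pad).length
  have h2 := length_encodeMatrix_le M
  have h3 := length_encodeResidues_le (hashFun M (xOf n (query n M x.toList pad)))
  have h4 : pad.length ≤ keyLen (n + 1) := by
    have : pad.length ≤ (query n M x.toList pad).length := by rw [length_query]; omega
    omega
  unfold inpBound
  omega

/-- The solver's coin supply at a genuine instance covers the budget of its dimension. [folklore] -/
theorem coinBudget_le_coinLen (A : RandAlg (List Bool) (List Bool)) (cb : ℕ → ℕ) {n : ℕ}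
    (M : Matrix (Fin n) (Fin (width n)) (ZMod (modulus n))) :
    coinBudget A cb n ≤ (sisSolver A cb).coinLen (encodeMatrix M).length := by
  change coinBudget A cb n ≤ (Finset.range ((encodeMatrix M).length + 1)).sup (coinBudget A cb)
  exact Finset.le_sup (f := coinBudget A cb)
    (Finset.mem_range.2 (Nat.lt_succ_of_le (le_length_encodeMatrix M)))

/-- The inverter's coin demand on a query in the block of `n` is within the budget. [folklore] -/
theorem coinLen_inpOf_le (A : RandAlg (List Bool) (List Bool)) {n : ℕ}
    (M : Matrix (Fin n) (Fin (width n)) (ZMod (modulus n))) (x : List.Vector Bool (width n))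
    {pad : List Bool} (hpad : pad.length < blockLen n) (hk : dimOf (query n M x.toList pad).length = n) :
    A.coinLen (inpOf (query n M x.toList pad)).length ≤ (Finset.range (inpBound n + 1)).sup A.coinLen :=
  Finset.le_sup (f := A.coinLen)
    (Finset.mem_range.2 (Nat.lt_succ_of_le (length_inpOf_query_le M x hpad hk)))

/-! ### Analysis III: probabilities as sums over coins -/

section Sums

open scoped Classical

/-- The success event of the inverter on query `w` minus the self-returns: a preimage whose
parsed vector differs from that of `w`. [folklore] -/
def goodSet (n : ℕ) (w : List Bool) : Set (List Bool) :=
  {z | sisFunction z = sisFunction w ∧ xOf n z ≠ xOf n w}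

/-- The self-return event: a preimage with the same parsed vector. [folklore] -/
def selfSet (n : ℕ) (w : List Bool) : Set (List Bool) :=
  {z | sisFunction z = sisFunction w ∧ xOf n z = xOf n w}

/-- `Pr[good] = Pr[preimage] - Pr[self-return]`. [folklore] -/
theorem pr_goodSet (A : RandAlg (List Bool) (List Bool)) (n : ℕ) (w : List Bool) :
    A.pr id (inpOf w) (goodSet n w) =
      A.pr id (inpOf w) {z | sisFunction z = sisFunction w} - A.pr id (inpOf w) (selfSet n w) := by
  rw [pr_eq_sum_div A id (inpOf w) (goodSet n w) (L := A.coinLen (inpOf w).length) rfl,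
    pr_eq_sum_div A id (inpOf w) _ (L := A.coinLen (inpOf w).length) rfl,
    pr_eq_sum_div A id (inpOf w) (selfSet n w) (L := A.coinLen (inpOf w).length) rfl, ← sub_div,
    ← Finset.sum_sub_distrib]
  congr 1
  refine Finset.sum_congr rfl fun r _ => ?_
  simp only [goodSet, selfSet, Set.mem_setOf_eq]
  by_cases h1 : sisFunction (A.run (inpOf w) r.toList) = sisFunction w
  · by_cases h2 : xOf n (A.run (inpOf w) r.toList) = xOf n w
    · rw [if_neg (fun h => h.2 h2), if_pos h1, if_pos ⟨h1, h2⟩]; norm_num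
    · rw [if_pos ⟨h1, h2⟩, if_pos h1, if_neg (fun h => h2 h.2)]; norm_num
  · rw [if_neg (fun h => h1 h.1), if_neg h1, if_neg (fun h => h1 h.1)]; norm_num

/-- Summing the indicator of the inverter's success over a coin supply of length `R ≥ coinLen`:
`∑_{r4 ∈ {0,1}^R} [A(inpOf w; r4↾coinLen) ∈ E] = 2^R · Pr[A(inpOf w) ∈ E]`. [folklore] -/
theorem sum_run_take_mem (A : RandAlg (List Bool) (List Bool)) (w : List Bool) (E : Set (List Bool))
    {R : ℕ} (hR : A.coinLen (inpOf w).length ≤ R) :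
    ∑ r4 : List.Vector Bool R,
        (if A.run (inpOf w) (r4.toList.take (A.coinLen (inpOf w).length)) ∈ E then (1 : ℝ) else 0) =
      2 ^ R * A.pr id (inpOf w) E := by
  rw [sum_vector_take hR (fun ρ => if A.run (inpOf w) ρ ∈ E then (1 : ℝ) else 0),
    pr_eq_sum_div A id (inpOf w) E (L := A.coinLen (inpOf w).length) rfl]
  have ha : (2 : ℝ) ^ R = 2 ^ (R - A.coinLen (inpOf w).length) * 2 ^ A.coinLen (inpOf w).length := by
    rw [← pow_add, Nat.sub_add_cancel hR]
  rw [ha, mul_assoc, mul_div_cancel₀ _ (pow_ne_zero _ two_ne_zero)]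

/-- **Guessing the inverter's coin count.** Summed over the guess coins `r5 ∈ {0,1}^ℓ` and a coin
supply `r4 ∈ {0,1}^R` (`R ≥ coinLen |inpOf w|`, `coinLen |inpOf w| ≤ cb |inpOf w| < 2^ℓ`), the
inverter's answer lies in `E` at least `2^R · Pr[A(inpOf w) ∈ E]` times: the guess
`r5 = natBits ℓ (coinLen |inpOf w|)` is right. [Goldreich 2001, §1.3.2] [folklore] -/
theorem sum_answer_mem_ge (A : RandAlg (List Bool) (List Bool)) (cb : ℕ → ℕ) (w : List Bool)
    (E : Set (List Bool)) {ℓ R : ℕ} (hR : A.coinLen (inpOf w).length ≤ R)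
    (hcb : A.coinLen (inpOf w).length ≤ cb (inpOf w).length) (hℓ : cb (inpOf w).length < 2 ^ ℓ) :
    2 ^ R * A.pr id (inpOf w) E ≤
      ∑ r5 : List.Vector Bool ℓ, ∑ r4 : List.Vector Bool R,
        (if answer A cb w r5.toList r4.toList ∈ E then (1 : ℝ) else 0) := by
  let r0 : List.Vector Bool ℓ :=
    ⟨Cryptography.natBits ℓ (A.coinLen (inpOf w).length), Cryptography.length_natBits _ _⟩
  have hr0 : bitsToNat r0.toList % (cb (inpOf w).length + 1) = A.coinLen (inpOf w).length := by
    change bitsToNat (Cryptography.natBits ℓ (A.coinLen (inpOf w).length)) %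
        (cb (inpOf w).length + 1) = _
    rw [bitsToNat_natBits (hcb.trans_lt hℓ), Nat.mod_eq_of_lt (Nat.lt_succ_of_le hcb)]
  have hnn : ∀ r5 ∈ (Finset.univ : Finset (List.Vector Bool ℓ)),
      (0 : ℝ) ≤ (fun r5 : List.Vector Bool ℓ => ∑ r4 : List.Vector Bool R,
        (if answer A cb w r5.toList r4.toList ∈ E then (1 : ℝ) else 0)) r5 := by
    intro r5 _
    exact Finset.sum_nonneg fun r4 _ => by split_ifs <;> norm_num
  have key := Finset.single_le_sum hnn (Finset.mem_univ r0)
  refine le_trans (le_of_eq ?_) key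
  show 2 ^ R * A.pr id (inpOf w) E = ∑ r4 : List.Vector Bool R,
    (if answer A cb w r0.toList r4.toList ∈ E then (1 : ℝ) else 0)
  simp only [answer, hr0]
  exact (sum_run_take_mem A w E hR).symm

end Sums


/-! ### Analysis IV: the solver's success on a fixed key -/

section PerKey

open scoped Classical

/-- The solution event on the instance `M` (outputs read with `decodeIntVec`, as in
`SIS.successProb'`). [Micciancio–Regev 2007, Def. 5.4] [folklore] -/
def solSet {n : ℕ} (M : Matrix (Fin n) (Fin (width n)) (ZMod (modulus n))) : Set (List Bool) :=
  {o | IsSolution' M (normBound n) (decodeIntVec (width n) o)}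

/-- **The solver's success probability on a fixed key `M` dominates the inverter's "good"
probability**, averaged over the `x`-part and the padding of length `p` (`k = keyLen n + p` in
the block of `n`), up to the factors `2^{guessBits n}` (length guess) and `2^{lenBits cb n}`
(coin-count guess): `2^{g} 2^{ℓ} · Pr_r[B(M; r) solves SIS′] ≥ 2^{-m-p} ∑_{x, pad} Pr[A returns a
preimage x' ≠ x]`, provided `cb` bounds the inverter's coin budget.
[Micciancio–Regev 2007, §5.1 (p. 18); Ajtai 1996, Thm. 1; Goldreich 2001, §2.4.2] [folklore] -/
theorem sum_pr_goodSet_le (A : RandAlg (List Bool) (List Bool)) {cb : ℕ → ℕ}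
    (hcb : ∀ ℓ, A.coinLen ℓ ≤ cb ℓ) {n : ℕ}
    (M : Matrix (Fin n) (Fin (width n)) (ZMod (modulus n))) {p : ℕ} (hp : p < blockLen n)
    (hk : dimOf (keyLen n + p) = n) :
    ∑ x : List.Vector Bool (width n), ∑ pad : List.Vector Bool p,
        A.pr id (inpOf (query n M x.toList pad.toList)) (goodSet n (query n M x.toList pad.toList))
      ≤ 2 ^ guessBits n * 2 ^ lenBits cb n * 2 ^ width n * 2 ^ p *
        (sisSolver A cb).pr id (encodeMatrix M) (solSet M) := by
  -- coin bookkeeping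
  have hbud := coinBudget_le_coinLen A cb M
  set cB := (sisSolver A cb).coinLen (encodeMatrix M).length with hcB_def
  obtain ⟨R, hR⟩ : ∃ R, cB = guessBits n + (width n + (blockLen n + (lenBits cb n + R))) :=
    ⟨cB - (guessBits n + width n + blockLen n + lenBits cb n), by unfold coinBudget at hbud; omega⟩
  have hSR : (Finset.range (inpBound n + 1)).sup A.coinLen ≤ R := by
    unfold coinBudget at hbud; omega
  have hlen : ∀ (x : List.Vector Bool (width n)) (pad : List Bool),
      (query n M x.toList pad).length = keyLen n + pad.length := by
    intro x pad; rw [length_query, x.toList_length]; unfold keyLen; omega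
  have hkq : ∀ (x : List.Vector Bool (width n)) (pad : List Bool), pad.length = p →
      dimOf (query n M x.toList pad).length = n := by
    intro x pad h; rw [hlen, h]; exact hk
  have hcoin : ∀ (x : List.Vector Bool (width n)) (pad : List Bool), pad.length = p →
      A.coinLen (inpOf (query n M x.toList pad)).length ≤ R := by
    intro x pad h
    exact (coinLen_inpOf_le A M x (h ▸ hp) (hkq x pad h)).trans hSR
  have hcbℓ : ∀ (x : List.Vector Bool (width n)) (pad : List Bool), pad.length = p →
      cb (inpOf (query n M x.toList pad)).length < 2 ^ lenBits cb n := by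
    intro x pad h
    exact lt_two_pow_lenBits (length_inpOf_query_le M x (h ▸ hp) (hkq x pad h))
  -- indicators
  let F : List Bool → ℝ := fun l =>
    if (sisSolver A cb).run (encodeMatrix M) l ∈ solSet M then 1 else 0
  let G : List.Vector Bool (width n) → List Bool → List Bool → List Bool → ℝ := fun x pad r5 r4 =>
    if answer A cb (query n M x.toList pad) r5 r4 ∈ goodSet n (query n M x.toList pad) then 1 else 0
  have hF0 : ∀ l, 0 ≤ F l := fun l => by simp only [F]; split_ifs <;> norm_num
  have hG0 : ∀ x pad r5 r4, 0 ≤ G x pad r5 r4 := fun x pad r5 r4 => by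
    simp only [G]; split_ifs <;> norm_num
  have hFG : ∀ (r1 : List.Vector Bool (guessBits n)) (x : List.Vector Bool (width n))
      (r3 : List.Vector Bool (blockLen n)) (r5 : List.Vector Bool (lenBits cb n)) (r4 : List Bool),
      (if bitsToNat r1.toList % blockLen n = p then (1 : ℝ) else 0) * G x (r3.toList.take p) r5.toList r4 ≤
        F (r1.toList ++ (x.toList ++ (r3.toList ++ (r5.toList ++ r4)))) := by
    intro r1 x r3 r5 r4
    by_cases hu : bitsToNat r1.toList % blockLen n = p
    · rw [if_pos hu, one_mul]
      by_cases hg : answer A cb (query n M x.toList (r3.toList.take p)) r5.toList r4 ∈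
          goodSet n (query n M x.toList (r3.toList.take p))
      · have hpad : (r3.toList.take p).length = p := by
          rw [List.length_take, r3.toList_length]; omega
        have hsol : (sisSolver A cb).run (encodeMatrix M)
            (r1.toList ++ (x.toList ++ (r3.toList ++ (r5.toList ++ r4)))) ∈ solSet M :=
          sisSolver_success A cb M r1 x r3 r5 r4 hu (hkq x _ hpad) hg.1 hg.2
        simp only [F, G, if_pos hg, if_pos hsol, le_refl]
      · simp only [G, if_neg hg]
        exact hF0 _
    · rw [if_neg hu, zero_mul]
      exact hF0 _
  -- the coin sum, decomposed
  have h1 : ∑ r : List.Vector Bool cB, F r.toList =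
      ∑ r1 : List.Vector Bool (guessBits n), ∑ x : List.Vector Bool (width n),
        ∑ r3 : List.Vector Bool (blockLen n), ∑ r5 : List.Vector Bool (lenBits cb n),
          ∑ r4 : List.Vector Bool R,
            F (r1.toList ++ (x.toList ++ (r3.toList ++ (r5.toList ++ r4.toList)))) := by
    rw [sum_vector_cast hR F, sum_vector_append (guessBits n) _ F]
    refine Finset.sum_congr rfl fun r1 _ => ?_
    rw [sum_vector_append (width n) _ (fun l => F (r1.toList ++ l))]
    refine Finset.sum_congr rfl fun x _ => ?_
    rw [sum_vector_append (blockLen n) _ (fun l => F (r1.toList ++ (x.toList ++ l)))]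
    refine Finset.sum_congr rfl fun r3 _ => ?_
    rw [sum_vector_append (lenBits cb n) R (fun l => F (r1.toList ++ (x.toList ++ (r3.toList ++ l))))]
  -- the guess is right with at least one coin string
  have h5 : (1 : ℝ) ≤ ∑ r1 : List.Vector Bool (guessBits n),
      (if bitsToNat r1.toList % blockLen n = p then (1 : ℝ) else 0) := by
    let r0 : List.Vector Bool (guessBits n) :=
      ⟨Cryptography.natBits (guessBits n) p, Cryptography.length_natBits _ _⟩
    have hr0 : bitsToNat r0.toList % blockLen n = p := by
      change bitsToNat (Cryptography.natBits (guessBits n) p) % blockLen n = p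
      rw [bitsToNat_natBits (hp.trans (blockLen_lt_two_pow_guessBits n)), Nat.mod_eq_of_lt hp]
    have hnn : ∀ r1 ∈ (Finset.univ : Finset (List.Vector Bool (guessBits n))),
        (0 : ℝ) ≤ (fun r1 : List.Vector Bool (guessBits n) =>
          (if bitsToNat r1.toList % blockLen n = p then (1 : ℝ) else 0)) r1 := by
      intro r1 _
      show (0 : ℝ) ≤ if bitsToNat r1.toList % blockLen n = p then (1 : ℝ) else 0
      split_ifs <;> norm_num
    have key := Finset.single_le_sum hnn (Finset.mem_univ r0)
    rw [if_pos hr0] at key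
    exact key
  -- the inner sums dominate probabilities
  have h6 : ∀ x : List.Vector Bool (width n),
      2 ^ (blockLen n - p) * ∑ pad : List.Vector Bool p,
          2 ^ R * A.pr id (inpOf (query n M x.toList pad.toList))
            (goodSet n (query n M x.toList pad.toList)) ≤
      ∑ r3 : List.Vector Bool (blockLen n), ∑ r5 : List.Vector Bool (lenBits cb n),
        ∑ r4 : List.Vector Bool R, G x (r3.toList.take p) r5.toList r4.toList := by
    intro x
    rw [sum_vector_take hp.le (fun l => ∑ r5 : List.Vector Bool (lenBits cb n),
      ∑ r4 : List.Vector Bool R, G x l r5.toList r4.toList)]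
    refine mul_le_mul_of_nonneg_left (Finset.sum_le_sum fun pad _ => ?_) (by positivity)
    exact sum_answer_mem_ge A cb _ _ (hcoin x _ pad.toList_length) (hcb _) (hcbℓ x _ pad.toList_length)
  -- assemble
  have hsum : 2 ^ (blockLen n - p) * 2 ^ R *
      ∑ x : List.Vector Bool (width n), ∑ pad : List.Vector Bool p,
        A.pr id (inpOf (query n M x.toList pad.toList)) (goodSet n (query n M x.toList pad.toList))
      ≤ ∑ r : List.Vector Bool cB, F r.toList := by
    calc 2 ^ (blockLen n - p) * 2 ^ R *
        ∑ x : List.Vector Bool (width n), ∑ pad : List.Vector Bool p,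
          A.pr id (inpOf (query n M x.toList pad.toList)) (goodSet n (query n M x.toList pad.toList))
        = 1 * ∑ x : List.Vector Bool (width n), 2 ^ (blockLen n - p) * ∑ pad : List.Vector Bool p,
            2 ^ R * A.pr id (inpOf (query n M x.toList pad.toList))
              (goodSet n (query n M x.toList pad.toList)) := by
          rw [one_mul, Finset.mul_sum]
          refine Finset.sum_congr rfl fun x _ => ?_
          rw [Finset.mul_sum, Finset.mul_sum]
          refine Finset.sum_congr rfl fun pad _ => ?_
          ring
      _ ≤ (∑ r1 : List.Vector Bool (guessBits n),
            (if bitsToNat r1.toList % blockLen n = p then (1 : ℝ) else 0)) *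
            ∑ x : List.Vector Bool (width n), ∑ r3 : List.Vector Bool (blockLen n),
              ∑ r5 : List.Vector Bool (lenBits cb n), ∑ r4 : List.Vector Bool R,
                G x (r3.toList.take p) r5.toList r4.toList := by
          refine mul_le_mul h5 (Finset.sum_le_sum fun x _ => h6 x) ?_ ?_
          · exact Finset.sum_nonneg fun x _ => mul_nonneg (by positivity)
              (Finset.sum_nonneg fun pad _ => mul_nonneg (by positivity) (RandAlg.pr_nonneg _ _ _ _))
          · exact Finset.sum_nonneg fun r1 _ => by split_ifs <;> norm_num
      _ = ∑ r1 : List.Vector Bool (guessBits n), ∑ x : List.Vector Bool (width n),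
            ∑ r3 : List.Vector Bool (blockLen n), ∑ r5 : List.Vector Bool (lenBits cb n),
              ∑ r4 : List.Vector Bool R,
                (if bitsToNat r1.toList % blockLen n = p then (1 : ℝ) else 0) *
                  G x (r3.toList.take p) r5.toList r4.toList := by
          rw [Finset.sum_mul]
          simp only [Finset.mul_sum]
      _ ≤ ∑ r1 : List.Vector Bool (guessBits n), ∑ x : List.Vector Bool (width n),
            ∑ r3 : List.Vector Bool (blockLen n), ∑ r5 : List.Vector Bool (lenBits cb n),
              ∑ r4 : List.Vector Bool R,
                F (r1.toList ++ (x.toList ++ (r3.toList ++ (r5.toList ++ r4.toList)))) := by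
          exact Finset.sum_le_sum fun r1 _ => Finset.sum_le_sum fun x _ =>
            Finset.sum_le_sum fun r3 _ => Finset.sum_le_sum fun r5 _ =>
              Finset.sum_le_sum fun r4 _ => hFG r1 x r3 r5 r4.toList
      _ = ∑ r : List.Vector Bool cB, F r.toList := h1.symm
  have h2cB : (2 : ℝ) ^ cB = 2 ^ guessBits n * 2 ^ lenBits cb n * 2 ^ width n * 2 ^ p *
      (2 ^ (blockLen n - p) * 2 ^ R) := by
    rw [hR, pow_add, pow_add, pow_add, pow_add]
    rw [show (2 : ℝ) ^ blockLen n = 2 ^ p * 2 ^ (blockLen n - p) by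
      rw [← pow_add, Nat.add_sub_cancel' hp.le]]
    ring
  rw [pr_eq_sum_div (sisSolver A cb) id (encodeMatrix M) (solSet M) (L := cB) (by rw [hcB_def]; rfl)]
  change _ ≤ 2 ^ guessBits n * 2 ^ lenBits cb n * 2 ^ width n * 2 ^ p *
    ((∑ r : List.Vector Bool cB, F r.toList) / 2 ^ cB)
  rw [mul_div_assoc', le_div_iff₀ (by positivity), h2cB]
  calc (∑ x : List.Vector Bool (width n), ∑ pad : List.Vector Bool p,
        A.pr id (inpOf (query n M x.toList pad.toList)) (goodSet n (query n M x.toList pad.toList))) *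
        (2 ^ guessBits n * 2 ^ lenBits cb n * 2 ^ width n * 2 ^ p * (2 ^ (blockLen n - p) * 2 ^ R))
      = 2 ^ guessBits n * 2 ^ lenBits cb n * 2 ^ width n * 2 ^ p * (2 ^ (blockLen n - p) * 2 ^ R *
        ∑ x : List.Vector Bool (width n), ∑ pad : List.Vector Bool p,
          A.pr id (inpOf (query n M x.toList pad.toList)) (goodSet n (query n M x.toList pad.toList))) := by
        ring
    _ ≤ 2 ^ guessBits n * 2 ^ lenBits cb n * 2 ^ width n * 2 ^ p * ∑ r : List.Vector Bool cB, F r.toList :=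
        mul_le_mul_of_nonneg_left hsum (by positivity)

end PerKey


/-! ### Analysis V: self-returns are rare (at most `qⁿ` of the `2^m` inputs) -/

section SelfReturn

open scoped Classical

/-- Counting form over any injectively indexed family of inputs (the indexed, real-valued
version of `SIS.card_filter_inv_hashFun_le`, which is the case `φ = boolVec`): for a fixed key
`M` and any would-be inverter `Inv` (a function of the image alone), `Inv (f_M (φ i)) = φ i`
holds for at most `qⁿ` indices `i` (on them `i ↦ f_M (φ i)` is injective). [Ajtai 1996, Thm. 1;
Micciancio–Regev 2007, §5.1 (p. 18)] [folklore] -/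
theorem sum_ite_inv_eq_le {ι : Type} [Fintype ι] {n m q : ℕ} [NeZero q]
    (M : Matrix (Fin n) (Fin m) (ZMod q)) (Inv : (Fin n → ZMod q) → (Fin m → ℤ)) (φ : ι → (Fin m → ℤ))
    (hφ : Function.Injective φ) :
    ∑ i, (if Inv (hashFun M (φ i)) = φ i then (1 : ℝ) else 0) ≤ (q : ℝ) ^ n := by
  rw [Finset.sum_boole]
  have hcard : (Finset.univ : Finset (Fin n → ZMod q)).card = q ^ n := by
    rw [Finset.card_univ, Fintype.card_fun, ZMod.card, Fintype.card_fin]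
  have h : (Finset.univ.filter fun i : ι => Inv (hashFun M (φ i)) = φ i).card ≤ q ^ n := by
    rw [← hcard]
    refine Finset.card_le_card_of_injOn (fun i => hashFun M (φ i)) (fun _ _ => Finset.mem_univ _) ?_
    intro i hi i' hi' h
    simp only [Finset.coe_filter, Finset.mem_univ, true_and, Set.mem_setOf_eq] at hi hi'
    apply hφ
    have h' : hashFun M (φ i) = hashFun M (φ i') := h
    rw [← hi, ← hi', h']
  exact_mod_cast h

/-- `x ↦ boolVec x.get` is injective on `{0,1}^m`. [folklore] -/
theorem boolVec_get_injective (m : ℕ) :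
    Function.Injective fun x : List.Vector Bool m => boolVec x.get := by
  intro x x' h
  have h1 := boolVec_injective m h
  exact List.Vector.ext fun i => congr_fun h1 i

/-- **Self-returns are rare.** For a fixed key `M` and padding, summed over the `2^m` choices of
`x`, the probability that the inverter returns a preimage with the SAME parsed vector `x` is at
most `qⁿ`: for fixed coins the inverter is a function of the image `f_M(x)` (`inpOf_query`), and
`sum_ite_inv_eq_le` applies. Dividing by `2^m`: `Pr_x[self-return] ≤ qⁿ/2^m`.
[Ajtai 1996, Thm. 1; Micciancio–Regev 2007, §5.1 (p. 18); Peikert 2016, §4.1.1] [folklore] -/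
theorem sum_pr_selfSet_le (A : RandAlg (List Bool) (List Bool)) {n : ℕ}
    (M : Matrix (Fin n) (Fin (width n)) (ZMod (modulus n))) {p : ℕ} (hp : p < blockLen n)
    (hk : dimOf (keyLen n + p) = n) (pad : List.Vector Bool p) :
    ∑ x : List.Vector Bool (width n),
        A.pr id (inpOf (query n M x.toList pad.toList)) (selfSet n (query n M x.toList pad.toList))
      ≤ (modulus n : ℝ) ^ n := by
  set Rh := (Finset.range (inpBound n + 1)).sup A.coinLen with hRh
  have hlen : ∀ x : List.Vector Bool (width n), (query n M x.toList pad.toList).length = keyLen n + p := by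
    intro x; rw [length_query, x.toList_length, pad.toList_length]; unfold keyLen; omega
  have hkq : ∀ x : List.Vector Bool (width n), dimOf (query n M x.toList pad.toList).length = n := by
    intro x; rw [hlen]; exact hk
  have ha : ∀ x : List.Vector Bool (width n),
      A.coinLen (inpOf (query n M x.toList pad.toList)).length ≤ Rh := fun x =>
    coinLen_inpOf_le A M x (by rw [pad.toList_length]; exact hp) (hkq x)
  -- the inverter's input as a function of the image, and the induced would-be inverter
  let Y : (Fin n → ZMod (modulus n)) → List Bool := fun v =>
    boolPair (unaryEncodeNat (keyLen n + p))
      (boolPair (encodeMatrix M) (boolPair (encodeResidues v) pad.toList))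
  have hY : ∀ x : List.Vector Bool (width n),
      inpOf (query n M x.toList pad.toList) = Y (hashFun M (xOf n (query n M x.toList pad.toList))) := by
    intro x
    rw [inpOf_query M x pad.toList (hkq x), hlen x]
  let Inv : List.Vector Bool Rh → (Fin n → ZMod (modulus n)) → (Fin (width n) → ℤ) := fun ρ v =>
    xOf n (A.run (Y v) (ρ.toList.take (A.coinLen (Y v).length)))
  -- each probability as a normalised sum over a common coin space `{0,1}^Rh`
  have hpr : ∀ x : List.Vector Bool (width n),
      A.pr id (inpOf (query n M x.toList pad.toList)) (selfSet n (query n M x.toList pad.toList)) =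
        (∑ ρ : List.Vector Bool Rh,
          (if A.run (inpOf (query n M x.toList pad.toList))
              (ρ.toList.take (A.coinLen (inpOf (query n M x.toList pad.toList)).length)) ∈
              selfSet n (query n M x.toList pad.toList) then (1 : ℝ) else 0)) / 2 ^ Rh := by
    intro x
    rw [pr_eq_sum_div A id (inpOf (query n M x.toList pad.toList)) (selfSet n (query n M x.toList pad.toList))
        (L := A.coinLen (inpOf (query n M x.toList pad.toList)).length) rfl,
      sum_vector_take (ha x) (fun ρ => if A.run (inpOf (query n M x.toList pad.toList)) ρ ∈
        selfSet n (query n M x.toList pad.toList) then (1 : ℝ) else 0)]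
    have h2 : (2 : ℝ) ^ Rh = 2 ^ (Rh - A.coinLen (inpOf (query n M x.toList pad.toList)).length) *
        2 ^ A.coinLen (inpOf (query n M x.toList pad.toList)).length := by
      rw [← pow_add, Nat.sub_add_cancel (ha x)]
    rw [h2, mul_div_mul_left _ _ (pow_ne_zero _ two_ne_zero)]
  -- pointwise: a self-return means the induced inverter returns `x` itself
  have hpt : ∀ (ρ : List.Vector Bool Rh) (x : List.Vector Bool (width n)),
      (if A.run (inpOf (query n M x.toList pad.toList))
          (ρ.toList.take (A.coinLen (inpOf (query n M x.toList pad.toList)).length)) ∈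
          selfSet n (query n M x.toList pad.toList) then (1 : ℝ) else 0) ≤
        (if Inv ρ (hashFun M (boolVec x.get)) = boolVec x.get then (1 : ℝ) else 0) := by
    intro ρ x
    split_ifs with h1 h2
    · exact le_rfl
    · exfalso
      apply h2
      have hx : xOf n (query n M x.toList pad.toList) = boolVec x.get := xOf_query M x pad.toList
      have := h1.2
      rw [hY x, hx] at this
      exact this
    · norm_num
    · exact le_rfl
  -- sum, swap, count
  calc ∑ x : List.Vector Bool (width n),
        A.pr id (inpOf (query n M x.toList pad.toList)) (selfSet n (query n M x.toList pad.toList))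
      = (∑ ρ : List.Vector Bool Rh, ∑ x : List.Vector Bool (width n),
          (if A.run (inpOf (query n M x.toList pad.toList))
              (ρ.toList.take (A.coinLen (inpOf (query n M x.toList pad.toList)).length)) ∈
              selfSet n (query n M x.toList pad.toList) then (1 : ℝ) else 0)) / 2 ^ Rh := by
        rw [Finset.sum_comm, Finset.sum_div]
        exact Finset.sum_congr rfl fun x _ => hpr x
    _ ≤ (∑ _ρ : List.Vector Bool Rh, (modulus n : ℝ) ^ n) / 2 ^ Rh := by
        apply div_le_div_of_nonneg_right _ (by positivity)
        refine Finset.sum_le_sum fun ρ _ => ?_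
        calc ∑ x : List.Vector Bool (width n),
              (if A.run (inpOf (query n M x.toList pad.toList))
                  (ρ.toList.take (A.coinLen (inpOf (query n M x.toList pad.toList)).length)) ∈
                  selfSet n (query n M x.toList pad.toList) then (1 : ℝ) else 0)
            ≤ ∑ x : List.Vector Bool (width n),
                (if Inv ρ (hashFun M (boolVec x.get)) = boolVec x.get then (1 : ℝ) else 0) :=
              Finset.sum_le_sum fun x _ => hpt ρ x
          _ ≤ (modulus n : ℝ) ^ n :=
              sum_ite_inv_eq_le M (Inv ρ) (fun x : List.Vector Bool (width n) => boolVec x.get)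
                (boolVec_get_injective (width n))
    _ = (modulus n : ℝ) ^ n := by
        rw [Finset.sum_const, Finset.card_univ, card_vector, Fintype.card_bool, nsmul_eq_mul]
        push_cast
        field_simp

end SelfReturn


/-! ### Analysis VI: averaging over the key recovers the inverter's success probability -/

section Average

open scoped Classical

/-- **Uniform coins give a uniform challenge.** Summed over all keys `M ∈ ℤ_q^{n×m}`, all
`x ∈ {0,1}^m` and all paddings of length `p`, the inverter's success probability on the query
`(M, x, pad)` is `2^k` times its inversion probability `invertProb sisFunction A k` at security
parameter `k = keyLen n + p` (`{0,1}^k ≃ ℤ_q^{n×m} × {0,1}^m × {0,1}^p` via `matrixToVec_bijective`).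
[Goldreich 2001, Def. 2.2.1 and §2.4.2; Ajtai 1996, Thm. 1] [folklore] -/
theorem sum_pr_succ_eq (A : RandAlg (List Bool) (List Bool)) (n p : ℕ) :
    ∑ M : Matrix (Fin n) (Fin (width n)) (ZMod (modulus n)), ∑ x : List.Vector Bool (width n),
      ∑ pad : List.Vector Bool p,
        A.pr id (inpOf (query n M x.toList pad.toList))
          {z | sisFunction z = sisFunction (query n M x.toList pad.toList)}
      = 2 ^ (keyLen n + p) * invertProb sisFunction A (keyLen n + p) := by
  let G : List Bool → ℝ := fun l =>
    A.pr id (boolPair (unaryEncodeNat (keyLen n + p)) (sisFunction l)) {z | sisFunction z = sisFunction l}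
  have hlen : ∀ (M : Matrix (Fin n) (Fin (width n)) (ZMod (modulus n))) (x : List.Vector Bool (width n))
      (pad : List.Vector Bool p), (query n M x.toList pad.toList).length = keyLen n + p := by
    intro M x pad; rw [length_query, x.toList_length, pad.toList_length]; unfold keyLen; omega
  have hk : keyLen n + p = n * width n * bitWidth n + (width n + p) := by unfold keyLen; omega
  calc ∑ M : Matrix (Fin n) (Fin (width n)) (ZMod (modulus n)), ∑ x : List.Vector Bool (width n),
        ∑ pad : List.Vector Bool p,
          A.pr id (inpOf (query n M x.toList pad.toList))
            {z | sisFunction z = sisFunction (query n M x.toList pad.toList)}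
      = ∑ M : Matrix (Fin n) (Fin (width n)) (ZMod (modulus n)), ∑ x : List.Vector Bool (width n),
          ∑ pad : List.Vector Bool p, G (matrixToBits (bitWidth n) M ++ (x.toList ++ pad.toList)) := by
        refine Finset.sum_congr rfl fun M _ => Finset.sum_congr rfl fun x _ =>
          Finset.sum_congr rfl fun pad _ => ?_
        simp only [G, inpOf, hlen]
        rfl
    _ = ∑ kb : List.Vector Bool (n * width n * bitWidth n), ∑ x : List.Vector Bool (width n),
          ∑ pad : List.Vector Bool p, G (kb.toList ++ (x.toList ++ pad.toList)) :=
        Fintype.sum_bijective (matrixToVec (bitWidth n)) (matrixToVec_bijective n (width n) (bitWidth n))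
          _ _ fun M => rfl
    _ = ∑ kb : List.Vector Bool (n * width n * bitWidth n), ∑ rest : List.Vector Bool (width n + p),
          G (kb.toList ++ rest.toList) := by
        refine Finset.sum_congr rfl fun kb _ => ?_
        rw [sum_vector_append (width n) p (fun l => G (kb.toList ++ l))]
    _ = ∑ w : List.Vector Bool (n * width n * bitWidth n + (width n + p)), G w.toList := by
        rw [sum_vector_append _ _ G]
    _ = ∑ w : List.Vector Bool (keyLen n + p), G w.toList := (sum_vector_cast hk G).symm
    _ = 2 ^ (keyLen n + p) * invertProb sisFunction A (keyLen n + p) := by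
        simp only [invertProb, uniformAvg, G]
        rw [mul_div_cancel₀ _ (pow_ne_zero _ two_ne_zero)]

end Average

/-! ### The success bound at one security parameter -/

section OneParameter

open scoped Classical

/-- **The reduction's guarantee at one security parameter.** For every inverter `A` with coin
budget bounded by `cb` and every input length `k` in the block of `n = dimOf k`:
`Pr[sisSolver A cb solves SIS′_{q,m,β} in dimension n] ≥ (invertProb A k - qⁿ/2^m) / (2^{guessBits n} 2^{lenBits cb n})`,
i.e. up to the polynomial losses of guessing the length and the coin count, the solver succeeds
whenever the inverter finds a preimage that is not a self-return (`sum_pr_goodSet_le`,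
`pr_goodSet`), self-returns having probability `≤ qⁿ/2^m` (`sum_pr_selfSet_le`), and the
uniform instance with the solver's uniform `x, pad` being exactly the inverter's challenge
distribution (`sum_pr_succ_eq`). [Micciancio–Regev 2007, §5.1 (p. 18); Ajtai 1996, Thm. 1;
Goldreich 2001, §2.4.2] [cite: MicciancioRegev2007, §5.1] -/
theorem successProb'_sisSolver_ge (A : RandAlg (List Bool) (List Bool)) {cb : ℕ → ℕ}
    (hcb : ∀ ℓ, A.coinLen ℓ ≤ cb ℓ) {k n : ℕ} (hn : dimOf k = n) :
    (invertProb sisFunction A k - (modulus n : ℝ) ^ n / 2 ^ width n) /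
        (2 ^ guessBits n * 2 ^ lenBits cb n) ≤
      successProb' (sisSolver A cb) n (width n) (modulus n) (normBound n) := by
  obtain ⟨hk1, hk2⟩ := dimOf_eq_iff.1 hn
  obtain ⟨p, rfl⟩ : ∃ p, k = keyLen n + p := ⟨k - keyLen n, by omega⟩
  have hp : p < blockLen n := by unfold blockLen; omega
  -- the four ingredients
  have ha := fun M : Matrix (Fin n) (Fin (width n)) (ZMod (modulus n)) => sum_pr_goodSet_le A hcb M hp hn
  have hc := fun (M : Matrix (Fin n) (Fin (width n)) (ZMod (modulus n))) (pad : List.Vector Bool p) =>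
    sum_pr_selfSet_le A M hp hn pad
  have hd := sum_pr_succ_eq A n p
  -- exponent bookkeeping
  have hQ : ((modulus n : ℕ) : ℝ) ^ (n * width n) = 2 ^ (n * width n * bitWidth n) := by
    rw [modulus_eq]; push_cast
    rw [← pow_mul, show bitWidth n * (n * width n) = n * width n * bitWidth n by ring]
  have h2k : (2 : ℝ) ^ (keyLen n + p) = 2 ^ (n * width n * bitWidth n) * 2 ^ width n * 2 ^ p := by
    unfold keyLen; rw [pow_add, pow_add]
  -- the sum over keys of the solver's success probabilities
  have hmain : 2 ^ (keyLen n + p) * invertProb sisFunction A (keyLen n + p) -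
      (modulus n : ℝ) ^ (n * width n) * 2 ^ p * (modulus n : ℝ) ^ n ≤
      2 ^ guessBits n * 2 ^ lenBits cb n * 2 ^ width n * 2 ^ p *
        ∑ M : Matrix (Fin n) (Fin (width n)) (ZMod (modulus n)),
          (sisSolver A cb).pr id (encodeMatrix M) (solSet M) := by
    rw [← hd, Finset.mul_sum]
    have hself : ∑ M : Matrix (Fin n) (Fin (width n)) (ZMod (modulus n)), ∑ x : List.Vector Bool (width n),
        ∑ pad : List.Vector Bool p,
          A.pr id (inpOf (query n M x.toList pad.toList)) (selfSet n (query n M x.toList pad.toList))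
        ≤ (modulus n : ℝ) ^ (n * width n) * 2 ^ p * (modulus n : ℝ) ^ n := by
      calc ∑ M : Matrix (Fin n) (Fin (width n)) (ZMod (modulus n)), ∑ x : List.Vector Bool (width n),
            ∑ pad : List.Vector Bool p,
              A.pr id (inpOf (query n M x.toList pad.toList)) (selfSet n (query n M x.toList pad.toList))
          ≤ ∑ _M : Matrix (Fin n) (Fin (width n)) (ZMod (modulus n)), ∑ _pad : List.Vector Bool p,
              (modulus n : ℝ) ^ n := by
            refine Finset.sum_le_sum fun M _ => ?_
            rw [Finset.sum_comm]
            exact Finset.sum_le_sum fun pad _ => hc M pad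
        _ = (modulus n : ℝ) ^ (n * width n) * 2 ^ p * (modulus n : ℝ) ^ n := by
            simp only [Finset.sum_const, Finset.card_univ, card_vector, Fintype.card_bool, card_matrix,
              nsmul_eq_mul]
            push_cast
            ring
    have hgood : ∑ M : Matrix (Fin n) (Fin (width n)) (ZMod (modulus n)), ∑ x : List.Vector Bool (width n),
        ∑ pad : List.Vector Bool p,
          A.pr id (inpOf (query n M x.toList pad.toList)) (goodSet n (query n M x.toList pad.toList))
        = ∑ M : Matrix (Fin n) (Fin (width n)) (ZMod (modulus n)), ∑ x : List.Vector Bool (width n),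
            ∑ pad : List.Vector Bool p,
              A.pr id (inpOf (query n M x.toList pad.toList))
                {z | sisFunction z = sisFunction (query n M x.toList pad.toList)} -
          ∑ M : Matrix (Fin n) (Fin (width n)) (ZMod (modulus n)), ∑ x : List.Vector Bool (width n),
            ∑ pad : List.Vector Bool p,
              A.pr id (inpOf (query n M x.toList pad.toList)) (selfSet n (query n M x.toList pad.toList)) := by
      rw [← Finset.sum_sub_distrib]
      refine Finset.sum_congr rfl fun M _ => ?_
      rw [← Finset.sum_sub_distrib]
      refine Finset.sum_congr rfl fun x _ => ?_
      rw [← Finset.sum_sub_distrib]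
      refine Finset.sum_congr rfl fun pad _ => ?_
      exact pr_goodSet A n _
    calc ∑ M : Matrix (Fin n) (Fin (width n)) (ZMod (modulus n)), ∑ x : List.Vector Bool (width n),
          ∑ pad : List.Vector Bool p,
            A.pr id (inpOf (query n M x.toList pad.toList))
              {z | sisFunction z = sisFunction (query n M x.toList pad.toList)} -
          (modulus n : ℝ) ^ (n * width n) * 2 ^ p * (modulus n : ℝ) ^ n
        ≤ ∑ M : Matrix (Fin n) (Fin (width n)) (ZMod (modulus n)), ∑ x : List.Vector Bool (width n),
            ∑ pad : List.Vector Bool p,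
              A.pr id (inpOf (query n M x.toList pad.toList)) (goodSet n (query n M x.toList pad.toList)) := by
          rw [hgood]; linarith [hself]
      _ ≤ ∑ M : Matrix (Fin n) (Fin (width n)) (ZMod (modulus n)),
            2 ^ guessBits n * 2 ^ lenBits cb n * 2 ^ width n * 2 ^ p *
              (sisSolver A cb).pr id (encodeMatrix M) (solSet M) :=
          Finset.sum_le_sum fun M _ => ha M
  -- divide through
  have hQpos : (0 : ℝ) < (modulus n : ℝ) ^ (n * width n) := by
    have := (modulus_neZero n).out
    positivity
  unfold successProb' matrixAvg
  change _ ≤ (∑ M : Matrix (Fin n) (Fin (width n)) (ZMod (modulus n)),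
    (sisSolver A cb).pr id (encodeMatrix M) (solSet M)) / (modulus n : ℝ) ^ (n * width n)
  rw [le_div_iff₀ hQpos, div_mul_eq_mul_div, div_le_iff₀ (by positivity)]
  calc (invertProb sisFunction A (keyLen n + p) - (modulus n : ℝ) ^ n / 2 ^ width n) *
        (modulus n : ℝ) ^ (n * width n)
      = (2 ^ (keyLen n + p) * invertProb sisFunction A (keyLen n + p) -
          (modulus n : ℝ) ^ (n * width n) * 2 ^ p * (modulus n : ℝ) ^ n) / (2 ^ width n * 2 ^ p) := by
        rw [h2k, hQ]
        field_simp
    _ ≤ (2 ^ guessBits n * 2 ^ lenBits cb n * 2 ^ width n * 2 ^ p *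
          ∑ M : Matrix (Fin n) (Fin (width n)) (ZMod (modulus n)),
            (sisSolver A cb).pr id (encodeMatrix M) (solSet M)) / (2 ^ width n * 2 ^ p) :=
        div_le_div_of_nonneg_right hmain (by positivity)
    _ = (∑ M : Matrix (Fin n) (Fin (width n)) (ZMod (modulus n)),
          (sisSolver A cb).pr id (encodeMatrix M) (solSet M)) * (2 ^ guessBits n * 2 ^ lenBits cb n) := by
        field_simp

end OneParameter


/-! ### The solver's coin budget is polynomial -/

section CoinBudget

open LWE

/-- Sums of polynomially bounded functions are polynomially bounded. Deliberate dot-notation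
extension of `Literature.Computability.Cryptography.LWE.IsPolyBounded` (file `LWENoise.lean`), like the following six lemmas. [folklore] -/
theorem _root_.Literature.Computability.Cryptography.LWE.IsPolyBounded.add {f g : ℕ → ℕ} (hf : LWE.IsPolyBounded f) (hg : LWE.IsPolyBounded g) :
    LWE.IsPolyBounded fun n => f n + g n := by
  obtain ⟨p, hp⟩ := hf; obtain ⟨q, hq⟩ := hg
  exact ⟨p + q, fun n => by rw [Polynomial.eval_add]; exact Nat.add_le_add (hp n) (hq n)⟩

/-- Products of polynomially bounded functions are polynomially bounded. [folklore] -/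
theorem _root_.Literature.Computability.Cryptography.LWE.IsPolyBounded.mul {f g : ℕ → ℕ} (hf : LWE.IsPolyBounded f) (hg : LWE.IsPolyBounded g) :
    LWE.IsPolyBounded fun n => f n * g n := by
  obtain ⟨p, hp⟩ := hf; obtain ⟨q, hq⟩ := hg
  exact ⟨p * q, fun n => by rw [Polynomial.eval_mul]; exact Nat.mul_le_mul (hp n) (hq n)⟩

/-- Constants are polynomially bounded. [folklore] -/
theorem _root_.Literature.Computability.Cryptography.LWE.IsPolyBounded.const (c : ℕ) : LWE.IsPolyBounded fun _ => c :=
  ⟨Polynomial.C c, fun n => by simp⟩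

/-- The identity is polynomially bounded. [folklore] -/
theorem _root_.Literature.Computability.Cryptography.LWE.IsPolyBounded.id : LWE.IsPolyBounded fun n => n :=
  ⟨Polynomial.X, fun n => by simp⟩

/-- A shift of a polynomially bounded function is polynomially bounded. [folklore] -/
theorem _root_.Literature.Computability.Cryptography.LWE.IsPolyBounded.comp_succ {f : ℕ → ℕ} (hf : LWE.IsPolyBounded f) : LWE.IsPolyBounded fun n => f (n + 1) := by
  obtain ⟨p, hp⟩ := hf
  exact ⟨p.comp (Polynomial.X + 1), fun n => by
    rw [Polynomial.eval_comp, Polynomial.eval_add, Polynomial.eval_X, Polynomial.eval_one]; exact hp _⟩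

/-- Domination by a polynomially bounded function. [folklore] -/
theorem _root_.Literature.Computability.Cryptography.LWE.IsPolyBounded.of_le {f g : ℕ → ℕ} (h : ∀ n, f n ≤ g n) (hg : LWE.IsPolyBounded g) : LWE.IsPolyBounded f := by
  obtain ⟨p, hp⟩ := hg
  exact ⟨p, fun n => (h n).trans (hp n)⟩

/-- A polynomially bounded function is dominated by a MONOTONE bound `c n^k + c`. [folklore] -/
theorem _root_.Literature.Computability.Cryptography.LWE.IsPolyBounded.exists_monotone_bound {f : ℕ → ℕ} (hf : LWE.IsPolyBounded f) :
    ∃ c k : ℕ, ∀ n, f n ≤ c * n ^ k + c := by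
  obtain ⟨p, hp⟩ := hf
  obtain ⟨c, k, hck⟩ := exists_eval_le_mul_pow_add p
  exact ⟨c, k, fun n => (hp n).trans (hck n)⟩

/-- `keyLen (n + 1)` is polynomially bounded. [folklore] -/
theorem isPolyBounded_keyLen_succ : LWE.IsPolyBounded fun n => keyLen (n + 1) :=
  IsPolyBounded.comp_succ isPolyBounded_keyLen

/-- `blockLen` is polynomially bounded. [folklore] -/
theorem isPolyBounded_blockLen : LWE.IsPolyBounded blockLen :=
  IsPolyBounded.of_le blockLen_le isPolyBounded_keyLen_succ

/-- `guessBits` is polynomially bounded (`g < 2^g ≤ 2 blockLen`). [folklore] -/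
theorem isPolyBounded_guessBits : LWE.IsPolyBounded guessBits :=
  IsPolyBounded.of_le (fun n => ((guessBits n).lt_two_pow_self.le.trans (two_pow_guessBits_le n)))
    (IsPolyBounded.mul (IsPolyBounded.const 2) isPolyBounded_blockLen)

/-- `inpBound` is polynomially bounded. [folklore] -/
theorem isPolyBounded_inpBound : LWE.IsPolyBounded inpBound := by
  have hk := isPolyBounded_keyLen_succ
  have hm : LWE.IsPolyBounded width := isPolyBounded_width
  have hq : LWE.IsPolyBounded modulus := isPolyBounded_modulus
  have h2 := IsPolyBounded.const 2
  have hres : LWE.IsPolyBounded fun n => resBound n (modulus n) := by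
    unfold resBound
    exact IsPolyBounded.add (IsPolyBounded.add (IsPolyBounded.mul h2 IsPolyBounded.id) h2)
      (IsPolyBounded.mul IsPolyBounded.id (IsPolyBounded.add (IsPolyBounded.mul h2 hq) h2))
  have hmat : LWE.IsPolyBounded fun n => matBound n (width n) (modulus n) := by
    unfold matBound
    refine IsPolyBounded.add (IsPolyBounded.add (IsPolyBounded.mul h2 IsPolyBounded.id) h2)
      (IsPolyBounded.add (IsPolyBounded.add (IsPolyBounded.mul h2 hm) h2)
        (IsPolyBounded.add (IsPolyBounded.add (IsPolyBounded.mul h2 hq) h2)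
          (IsPolyBounded.add (IsPolyBounded.add (IsPolyBounded.mul h2 IsPolyBounded.id) h2)
            (IsPolyBounded.mul IsPolyBounded.id (IsPolyBounded.add (IsPolyBounded.mul h2
              (IsPolyBounded.add (IsPolyBounded.add (IsPolyBounded.mul h2 hm) h2)
                (IsPolyBounded.mul hm (IsPolyBounded.add (IsPolyBounded.mul h2 hq) h2)))) h2)))))
  unfold inpBound
  exact IsPolyBounded.add (IsPolyBounded.add (IsPolyBounded.mul h2 hk) h2)
    (IsPolyBounded.add (IsPolyBounded.add (IsPolyBounded.mul h2 hmat) h2)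
      (IsPolyBounded.add (IsPolyBounded.add (IsPolyBounded.mul h2 hres) h2) hk))

/-- A `Finset.sup` of a polynomially bounded function over the ranges `[0, inpBound n]` is
polynomially bounded in `n` (through a monotone bound `c ℓ^k + c`). [folklore] -/
theorem isPolyBounded_sup_range_inpBound {f : ℕ → ℕ} (hf : LWE.IsPolyBounded f) :
    LWE.IsPolyBounded fun n => (Finset.range (inpBound n + 1)).sup f := by
  obtain ⟨c, k, hck⟩ := IsPolyBounded.exists_monotone_bound hf
  have hsup : ∀ n, (Finset.range (inpBound n + 1)).sup f ≤ c * inpBound n ^ k + c := by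
    intro n
    refine Finset.sup_le fun ℓ hℓ => (hck ℓ).trans ?_
    have : ℓ ≤ inpBound n := Nat.lt_succ_iff.1 (Finset.mem_range.1 hℓ)
    gcongr
  refine IsPolyBounded.of_le hsup ?_
  obtain ⟨q, hq⟩ := isPolyBounded_inpBound
  exact IsPolyBounded.add (IsPolyBounded.mul (IsPolyBounded.const c)
    ⟨q ^ k, fun n => by rw [Polynomial.eval_pow]; exact Nat.pow_le_pow_left (hq n) k⟩) (IsPolyBounded.const c)

/-- `2 ^ lenBits cb n` is polynomially bounded when `cb` is. [folklore] -/
theorem isPolyBounded_two_pow_lenBits {cb : ℕ → ℕ} (hcb : LWE.IsPolyBounded cb) :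
    LWE.IsPolyBounded fun n => 2 ^ lenBits cb n :=
  IsPolyBounded.of_le (two_pow_lenBits_le cb) (IsPolyBounded.mul (IsPolyBounded.const 2)
    (IsPolyBounded.add (isPolyBounded_sup_range_inpBound hcb) (IsPolyBounded.const 1)))

/-- `2 ^ guessBits n` is polynomially bounded. [folklore] -/
theorem isPolyBounded_two_pow_guessBits : LWE.IsPolyBounded fun n => 2 ^ guessBits n :=
  IsPolyBounded.of_le two_pow_guessBits_le (IsPolyBounded.mul (IsPolyBounded.const 2) isPolyBounded_blockLen)

/-- The per-dimension coin budget is polynomially bounded when the inverter's budget and its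
bound `cb` are. [folklore] -/
theorem isPolyBounded_coinBudget (A : RandAlg (List Bool) (List Bool)) {cb : ℕ → ℕ}
    (hA : ∃ p : Polynomial ℕ, ∀ n, A.coinLen n ≤ p.eval n) (hcb : LWE.IsPolyBounded cb) :
    LWE.IsPolyBounded (coinBudget A cb) := by
  unfold coinBudget
  refine IsPolyBounded.add (IsPolyBounded.add (IsPolyBounded.add (IsPolyBounded.add isPolyBounded_guessBits
    isPolyBounded_width) isPolyBounded_blockLen)
    (IsPolyBounded.of_le (fun n => (lenBits cb n).lt_two_pow_self.le) (isPolyBounded_two_pow_lenBits hcb)))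
    (isPolyBounded_sup_range_inpBound hA)

/-- **The solver's coin budget is polynomially bounded** (the elementary half of "the solver is
PPT"). [Goldreich 2001, §1.3.2] [folklore] -/
theorem sisSolver_coinLen_isPolyBounded (A : RandAlg (List Bool) (List Bool)) {cb : ℕ → ℕ}
    (hA : ∃ p : Polynomial ℕ, ∀ n, A.coinLen n ≤ p.eval n) (hcb : LWE.IsPolyBounded cb) :
    ∃ p : Polynomial ℕ, ∀ N, (sisSolver A cb).coinLen N ≤ p.eval N := by
  obtain ⟨c, k, hck⟩ := IsPolyBounded.exists_monotone_bound (isPolyBounded_coinBudget A hA hcb)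
  refine ⟨Polynomial.C c * Polynomial.X ^ k + Polynomial.C c, fun N => ?_⟩
  simp only [Polynomial.eval_add, Polynomial.eval_mul, Polynomial.eval_C, Polynomial.eval_pow,
    Polynomial.eval_X]
  change (Finset.range (N + 1)).sup (coinBudget A cb) ≤ c * N ^ k + c
  refine Finset.sup_le fun n hn => (hck n).trans ?_
  have : n ≤ N := Nat.lt_succ_iff.1 (Finset.mem_range.1 hn)
  gcongr

end CoinBudget

/-! ### Asymptotics: from one parameter to the reduction statement -/

section Asymptotics

/-- `qⁿ / 2^m ≤ 1 / 2ⁿ` for the concrete parameters (`qⁿ = 2^{t n}`, `2^m = 2^{2 n t}`, `t ≥ 1`).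
[Ajtai 1996, Thm. 1 (compressing parameters)] [folklore] -/
theorem modulus_pow_div_le (n : ℕ) : (modulus n : ℝ) ^ n / 2 ^ width n ≤ 1 / 2 ^ n := by
  rw [div_le_div_iff₀ (by positivity) (by positivity), one_mul, modulus_eq]
  push_cast
  rw [← pow_mul, ← pow_add]
  refine pow_le_pow_right₀ one_le_two ?_
  unfold width
  have := sixteen_le_bitWidth n
  nlinarith

/-- **The reduction statement for the concrete solver** (probabilistic core of the SIS-function
step, in the format of `Literature.Computability.Cryptography.Ajtai1996_sisFunction_core`): for every inverter `A` whose coin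
budget is bounded by a polynomially bounded `cb`, and every exponent `c`, there are `c', k₀` such
that for all `k ≥ k₀`, if `A` inverts `sisFunction` at security parameter `k` with probability
`≥ 1/kᶜ` then `sisSolver A cb` solves SIS′ in dimension `n = dimOf k` with probability
`≥ 1/n^{c'}`. From `successProb'_sisSolver_ge`: with `H n = keyLen (n+1) + 2^{guessBits n} 2^{lenBits cb n} ≤ C₁ nᵈ`
(`n ≥ 1`) one has `k ≤ C₁ nᵈ`, `qⁿ/2^m ≤ 2^{-n} ≤ 1/(2kᶜ)` eventually, so the bound is
`≥ 1/(2 C₁^{c+1} n^{d(c+1)}) ≥ 1/n^{d(c+1)+1}` eventually. [Micciancio–Regev 2007, §5.1 (p. 18);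
Ajtai 1996, Thm. 1; Goldreich 2001, §2.4.2] [cite: MicciancioRegev2007, §5.1] -/
theorem sisSolver_reduction (A : RandAlg (List Bool) (List Bool)) {cb : ℕ → ℕ}
    (hcb : ∀ ℓ, A.coinLen ℓ ≤ cb ℓ) (hcbpoly : LWE.IsPolyBounded cb) (c : ℕ) :
    ∃ c' k₀ : ℕ, ∀ k : ℕ, k₀ ≤ k → 1 / (k : ℝ) ^ c ≤ invertProb sisFunction A k →
      1 / (dimOf k : ℝ) ^ c' ≤
        successProb' (sisSolver A cb) (dimOf k) (width (dimOf k)) (modulus (dimOf k)) (normBound (dimOf k)) := by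
  -- one monotone polynomial bound `H n ≤ C₁ nᵈ` (`n ≥ 1`) for `keyLen (n+1)` and the guess factors
  obtain ⟨C, d, hCd⟩ := IsPolyBounded.exists_monotone_bound (IsPolyBounded.add isPolyBounded_keyLen_succ
    (IsPolyBounded.mul isPolyBounded_two_pow_guessBits (isPolyBounded_two_pow_lenBits hcbpoly)))
  set C₁ : ℝ := 2 * C + 1 with hC₁
  have hC₁1 : (1 : ℝ) ≤ C₁ := by rw [hC₁]; have : (0 : ℝ) ≤ C := Nat.cast_nonneg C; linarith
  have hH : ∀ n : ℕ, 1 ≤ n →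
      (keyLen (n + 1) : ℝ) + 2 ^ guessBits n * 2 ^ lenBits cb n ≤ C₁ * (n : ℝ) ^ d := by
    intro n hn
    have h1 : ((keyLen (n + 1) + 2 ^ guessBits n * 2 ^ lenBits cb n : ℕ) : ℝ) ≤ ((C * n ^ d + C : ℕ) : ℝ) := by
      exact_mod_cast hCd n
    push_cast at h1
    have h2 : (1 : ℝ) ≤ (n : ℝ) ^ d := one_le_pow₀ (by exact_mod_cast hn)
    have h3 : (0 : ℝ) ≤ C := Nat.cast_nonneg C
    rw [hC₁]; nlinarith
  -- exponential beats polynomial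
  obtain ⟨n₁, hn₁⟩ : ∃ n₁ : ℕ, ∀ n : ℕ, n₁ ≤ n → 2 * (C₁ * (n : ℝ) ^ d) ^ c ≤ (2 : ℝ) ^ n := by
    have hε : (0 : ℝ) < 1 / (2 * C₁ ^ c) := by positivity
    have ht := (tendsto_pow_const_div_const_pow_of_one_lt (d * c) (one_lt_two (α := ℝ))).eventually
      (Iic_mem_nhds hε)
    obtain ⟨n₁, hn₁⟩ := Filter.eventually_atTop.1 ht
    refine ⟨n₁, fun n hn => ?_⟩
    have h : (n : ℝ) ^ (d * c) / 2 ^ n ≤ 1 / (2 * C₁ ^ c) := hn₁ n hn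
    rw [div_le_div_iff₀ (by positivity) (by positivity), one_mul] at h
    calc 2 * (C₁ * (n : ℝ) ^ d) ^ c = (n : ℝ) ^ (d * c) * (2 * C₁ ^ c) := by rw [mul_pow, ← pow_mul]; ring
      _ ≤ (2 : ℝ) ^ n := h
  obtain ⟨n₂, hn₂⟩ : ∃ n₂ : ℕ, (2 * C₁ ^ (c + 1) : ℝ) ≤ n₂ := exists_nat_ge _
  refine ⟨d * (c + 1) + 1, keyLen (max 1 (max n₁ n₂)), fun k hk hinv => ?_⟩
  -- the dimension is large
  have hn0 : max 1 (max n₁ n₂) ≤ dimOf k := le_dimOf hk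
  set n := dimOf k with hn
  have h1n : 1 ≤ n := le_trans (le_max_left _ _) hn0
  have hn1n : n₁ ≤ n := le_trans ((le_max_left _ _).trans (le_max_right _ _)) hn0
  have hn2n : n₂ ≤ n := le_trans ((le_max_right _ _).trans (le_max_right _ _)) hn0
  have hnpos : (0 : ℝ) < n := by exact_mod_cast h1n
  have hX : (0 : ℝ) < C₁ * (n : ℝ) ^ d := by positivity
  -- k and the guess factors are polynomial in n
  have hkK : (k : ℝ) ≤ C₁ * (n : ℝ) ^ d := by
    have h1 : (k : ℝ) ≤ keyLen (n + 1) := by exact_mod_cast (lt_keyLen_dimOf_succ k).le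
    have h2 : (0 : ℝ) ≤ 2 ^ guessBits n * 2 ^ lenBits cb n := by positivity
    linarith [hH n h1n]
  have hk0 : (0 : ℝ) < k := by
    have : 1 ≤ k := le_trans (le_keyLen 1) ((keyLen_strictMono.monotone (le_max_left 1 (max n₁ n₂))).trans hk)
    exact_mod_cast this
  have hg : (2 : ℝ) ^ guessBits n * 2 ^ lenBits cb n ≤ C₁ * (n : ℝ) ^ d := by
    have h2 : (0 : ℝ) ≤ keyLen (n + 1) := Nat.cast_nonneg _
    linarith [hH n h1n]
  -- step 1: the numerator is at least `1/(2 (C₁ nᵈ)ᶜ)`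
  have step1 : 1 / (2 * (C₁ * (n : ℝ) ^ d) ^ c) ≤
      invertProb sisFunction A k - (modulus n : ℝ) ^ n / 2 ^ width n := by
    have i1 : 1 / (C₁ * (n : ℝ) ^ d) ^ c ≤ 1 / (k : ℝ) ^ c :=
      one_div_le_one_div_of_le (pow_pos hk0 c) (pow_le_pow_left₀ hk0.le hkK c)
    have i2 : (modulus n : ℝ) ^ n / 2 ^ width n ≤ 1 / (2 * (C₁ * (n : ℝ) ^ d) ^ c) := by
      refine (modulus_pow_div_le n).trans ?_
      exact one_div_le_one_div_of_le (by positivity) (hn₁ n hn1n)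
    have i3 : 1 / (2 * (C₁ * (n : ℝ) ^ d) ^ c) = 1 / (C₁ * (n : ℝ) ^ d) ^ c - 1 / (2 * (C₁ * (n : ℝ) ^ d) ^ c) := by
      field_simp; ring
    linarith
  -- step 2: divide by the guess factors
  have step2 : 1 / (n : ℝ) ^ (d * (c + 1) + 1) ≤
      1 / (2 * (C₁ * (n : ℝ) ^ d) ^ c) / (2 ^ guessBits n * 2 ^ lenBits cb n) := by
    rw [le_div_iff₀ (by positivity)]
    calc 1 / (n : ℝ) ^ (d * (c + 1) + 1) * (2 ^ guessBits n * 2 ^ lenBits cb n)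
        ≤ 1 / (n : ℝ) ^ (d * (c + 1) + 1) * (C₁ * (n : ℝ) ^ d) :=
          mul_le_mul_of_nonneg_left hg (by positivity)
      _ ≤ 1 / (2 * (C₁ * (n : ℝ) ^ d) ^ c) := by
          rw [div_mul_eq_mul_div, one_mul, div_le_div_iff₀ (by positivity) (by positivity), one_mul]
          have hn2' : (2 * C₁ ^ (c + 1) : ℝ) ≤ n := hn₂.trans (by exact_mod_cast hn2n)
          calc C₁ * (n : ℝ) ^ d * (2 * (C₁ * (n : ℝ) ^ d) ^ c)
              = 2 * C₁ ^ (c + 1) * (n : ℝ) ^ (d * (c + 1)) := by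
                rw [mul_pow, ← pow_mul, show d * (c + 1) = d * c + d by ring, pow_add, pow_succ]; ring
            _ ≤ (n : ℝ) * (n : ℝ) ^ (d * (c + 1)) := mul_le_mul_of_nonneg_right hn2' (by positivity)
            _ = (n : ℝ) ^ (d * (c + 1) + 1) := by ring
  exact step2.trans ((div_le_div_of_nonneg_right step1 (by positivity)).trans
    (successProb'_sisSolver_ge A hcb hn.symm))

end Asymptotics

end SIS

/-! ### The named fact and the assembly of the SIS-function step -/

section PQC

open SIS

/-- NAMED FACT (TM2 level; nothing asserted). **The reduction runs in polynomial time, given that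
Ajtai's function does**: if `SIS.sisFunction` is polynomial-time computable (the separately named
debt `sisFunction_polyTimeComputable` of `SISFunction.lean`, which this fact therefore does NOT
re-absorb), then for every PPT inverter `A` and polynomial `p` the map
`(inp, r) ↦ (SIS.sisSolver A (p.eval ·)).run inp r` is polynomial-time computable as a function of
`boolPair inp r`. Machine composition itself is available in the tree
(`Literature.Computability.Complexity.PolyTimeComputable.comp_holds`, `polyTimeComputable_boolUnpair`, the pairing
projections of `PairProjections.lean`); what a discharge still has to supply are TM2 routines (or
stack programs, `StackPrograms.lean`) for the string operations of `SIS.sisSolver.run` and their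
assembly: reading the dimension and the key bits off the instance (`SIS.nOf`, `SIS.keyOf`: iterated
`boolUnpair`, padding of the entry numerals to `t` bits), `take`/`drop` of the coin string at the computed offsets
`blockLen`, `guessBits`, `lenBits` (which involve `Nat.log`), `bitsToNat` and reduction `mod`,
evaluating `p` and the maximum `cbMax` over the block (a `sup` over `range (inpBound n + 1)`),
the length-dependent call of `A.run` on `(1^{k'}, sisFunction (A', x, pad))` with the guessed
coin count, `parseVec`, the subtraction `x - x'` and the output code `encodeIntVec` — each
polynomial in `|inp| + |r|` because every intermediate word is (dimension cap, polynomial coin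
budget `SIS.sisSolver_coinLen_isPolyBounded`). Compare `liuPassDistRun_polyTime`
(`LiuPassCondEPPRG.lean`) for the same kind of residual statement.
[Ajtai 1996, Thm. 1; Micciancio–Regev 2007, §5.1; Arora–Barak 2009, §1.3 and Def. 7.1] [cite: AroraBarak2009, Def. 7.1] -/
def sisSolver_polyTime : Prop :=
  sisFunction_polyTimeComputable →
  ∀ (A : RandAlg (List Bool) (List Bool)) (p : Polynomial ℕ), IsPPT A id →
    PolyTimeComputable (fun w : List Bool × List Bool => boolPair (id w.1) w.2) id
      (Function.uncurry (SIS.sisSolver A fun ℓ => p.eval ℓ).run)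

/-- **The probabilistic core of the SIS-function step, proved up to running time**: the named
fact `Ajtai1996_sisFunction_core` of `SISFunction.lean` follows from the polynomial running time
of Ajtai's function (`sisFunction_polyTimeComputable`) and of the explicit reduction
`SIS.sisSolver` given the former (`sisSolver_polyTime`), instantiated with the
inverter's own coin polynomial as the bound `cb`; its success guarantee is the theorem
`SIS.sisSolver_reduction` and its coin budget is polynomial by
`SIS.sisSolver_coinLen_isPolyBounded`. [Micciancio–Regev 2007, §5.1 (p. 18); Ajtai 1996, Thm. 1;
Goldreich 2001, §2.4.2] [cite: MicciancioRegev2007, §5.1 (with Ajtai 1996 Thm 1)] -/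
theorem Ajtai1996_sisFunction_core_of_solver (hf : sisFunction_polyTimeComputable)
    (h : sisSolver_polyTime) : Ajtai1996_sisFunction_core := by
  intro A hA c
  obtain ⟨p, hp⟩ := hA.2
  obtain ⟨c', k₀, hred⟩ := sisSolver_reduction A (cb := fun ℓ => p.eval ℓ) hp ⟨p, fun _ => le_rfl⟩ c
  exact ⟨sisSolver A fun ℓ => p.eval ℓ, ⟨h hf A p hA, sisSolver_coinLen_isPolyBounded A hA.2 ⟨p, fun _ => le_rfl⟩⟩,
    c', k₀, hred⟩

end PQC

end Literature.Computability.Cryptography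

end
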